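import Literature.MathematicalPhysics.QuantumLattice.XYZGroundStateOrder
import Literature.MathematicalPhysics.QuantumLattice.XYOrderGDProofs
import Literature.MathematicalPhysics.QuantumLattice.HeisenbergOrderNeelInfrared
import Literature.MathematicalPhysics.QuantumLattice.HeisenbergOrderNeelProofs
import Literature.MathematicalPhysics.QuantumLattice.HeisenbergOrderDLSProofs
import Literature.MathematicalPhysics.QuantumLattice.FinDimSpectrumGibbsLimitProofs
import Mathlib.Algebra.QuadraticDiscriminant
import HarnessLib

/-!
# Björnberg–Ueltschi, spin-½ planar window: the finite-volume architecture and the assembly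

Topic `MathematicalPhysics/QuantumLattice`; second sibling proof file of `XYZGroundStateOrder.lean`
(named fact `bjornbergUeltschi2022_ground_lro_spinHalf`, item
`provefact-Literature.MathematicalPhysics.QuantumLa-089185f5fb`). No statement of the tree is
changed and no named fact is introduced. This file reduces the fact to ground-state **Gaussian
domination** for the anisotropic nearest-neighbour model (proved in the third sibling
`XYZGroundStateOrderGD.lean`, which then discharges the fact), following Björnberg–Ueltschi,
*Reflection positivity and infrared bounds for quantum spin systems* (2022), Theorem 3.2 (second
lower bound) and its proof, §4 (4.26)–(4.42), at `β = ∞` — i.e. along the direct ground-state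
route of Kennedy–Lieb–Shastry (J. Stat. Phys. 53 (1988); PRL 61 (1988)) that the tree has already
formalised for the two endpoints of the window (`XYOrder*.lean`, `HeisenbergOrderNeel*.lean`),
whose abstract cores are reused verbatim (`Matrix.groundState_infraredBound_quadratic`, the modes
`xyCosMode`/`xySinMode`, `xyGradField_cos`, the bond double commutators `lie_lie_bond`,
`lie_lie_zbond`, the Fourier core `sum_structureFactor_mul_cos`, the KLS integrand and its
punctured Riemann sums `klsRiemannSum`).

## The frame

The fact concerns `H₀ = anisotropicTorus d L n J₁ J₂ 1 = -Σ_x Σ_{y∼x} (J₁S⁰S⁰ + J₂S¹S¹ + S²S²)`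
(B–U eq. (2.4): ordered pairs, `J⁽³⁾ = 1 ≥ J⁽¹⁾ = J₁ ≥ -J⁽²⁾ = -J₂ ≥ 0`) and long-range order
of the THIRD component `S² = Sᶻ`. All the tree's machinery (modes, field terms, real bond
matrices) is written for the FIRST component `S⁰ = Sˣ`. We therefore work with the globally
rotated Hamiltonian `H' = anisotropicTorus d L n 1 J₂ J₁ = W H₀ Wᴴ`, `W = ⨂_x V`,
`V Sᶻ Vᴴ = Sˣ` (`exists_unitary_conj_spinZ_eq_spinX`), whose `S⁰S⁰` ground-state correlations
are the `S²S²` correlations of `H₀` (`groundStateAxisCorrTorus_eq_xyzGroundCorr`; covariance of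
the tracial ground state under unitary conjugation is obtained from the covariance of Gibbs
states, `Matrix.gibbsState_conjTranspose_mul_mul`, and their zero-temperature limit,
`Matrix.tendsto_gibbsState_atTop_holds`). In this frame B–U's axes `(1, 2, 3)` are our spin
components `(2, 1, 0)`.

## Contents (B–U's steps, in finite volume `L = 2k ≥ 4`, tracial ground state `ω` of `H'`)

* `sum_ite_torusGraph_adj'`, `anisotropicTorus_eq_pairSum`: for `L ≥ 3` the ordered-pair sum is
  twice the sum over the bonds `(x, x + eᵢ)`.
* The objects: `xyzGroundCorr α` (`Gᵅ(x,y) = Re ω(Sᵅ_xSᵅ_y)`), `xyzStructureFactor` (`ĝ⁰_q`),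
  `xyzBondCorr α` (`cᵅ`, the site- and direction-averaged nearest-neighbour correlation).
* **(C) the sum rule** (B–U (4.38); KLS eq. (3)) `|Λ|⁻¹ Σ_q ĝ⁰_q (d⁻¹Σᵢ cos qᵢ) = c⁰`
  (`xyz_structureFactor_sumRule`).
* **(E) the energy** `E₀(H') = Re ω(H') = -2d|Λ|(c⁰ + J₂c¹ + J₁c²)` and, for every coupling
  triple, `Re ω(H(a,b,c)) = -2d|Λ|(ac⁰ + bc¹ + cc²)` (`re_groundStateFunctional_anisotropicTorus`).
* **(V) the variational bound with the fully polarised state** (B–U (3.10)/Kubo–Kishi: "the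
  variational principle with the constant state `⊗|½⟩`"): `c⁰ + J₂c¹ + J₁c² ≥ S²`
  (`xyz_polarised_bound`), through `E₀(H') = E₀(H₀) ≤ ⟨↑…↑|H₀|↑…↑⟩ = -2d|Λ|S²`.
* **(O) "the energy could be lowered by interchanging spin directions"** (B–U Prop. 2.4 and Lemma
  A.1's role, here by Kubo's variational argument as in the tree's `kubo_xy_bondCorr_abs_le_holds`):
  comparing `E₀(H') ≤ Re ω(U H' Uᴴ)` for the quarter turn about `Sˣ`, the `π`-rotation about `Sˣ`
  on the odd sublattice, their composite, and `W` gives `(J₁ - J₂)(c² - c¹) ≥ 0`,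
  `J₂c¹ + J₁c² ≥ 0`, `(J₁ + J₂)(c¹ + c²) ≥ 0`, `(1 - J₁)(c⁰ - c²) ≥ 0` (and `c⁰ = c²` for
  `J₁ = 1` by symmetry), whence B–U (4.42): `(J₁ - J₂) c⁰ ≥ J₁ (J₂c¹ + J₁c²)`
  (`xyz_orbit_inequalities`, `xyz_bu442`).
* **(A) the infrared bound at `T = 0`** (B–U Lemma 4.4 at `β = ∞`, with `e(k)` of (4.26)/(4.33)):
  from Gaussian domination `E₀(H') ≤ E₀(H' - 2V_h + Q(h))` for all real fields `h`,
  `0 ≤ ĝ⁰_q` and `(ĝ⁰_q)² E_q ≤ ¼ Σᵢ (α' - β' cos qᵢ)`, `α' = J₂c¹ + J₁c²`, `β' = J₁c¹ + J₂c²`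
  (`xyz_infraredBound_of_groundEnergy_le`; the double commutator
  `[A,[H',A]] = ΣΣ((a_x² + a_y²)(J₂S¹S¹ + J₁S²S²) - 2a_xa_y(J₂S²S² + J₁S¹S¹))`, B–U (4.28), and
  direction independence by axis permutations).
* **Assembly** (`bjornbergUeltschi2022_ground_lro_spinHalf_of_gaussianDomination`): for `d = 2`,
  `S = ½`: `ℓ⁻ᵈ ĝ⁰_0 ≥ c⁰ - ½√α' R_ℓ` ((C)+(A)+(O), `R_ℓ = klsRiemannSum 2 ℓ`), and
  `c⁰ ≥ max(¼ - α', α'/(1+ρ))` ((V), (4.42), `ρ = -J₂/J₁ ≤ 0.109`); with `R_ℓ ≤ 0.651`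
  eventually (`klsRiemannSum_two_eventually_le`) this is `≥ 1/2500` uniformly (`bu_positivity`).

## Deviation from the printed argument (recorded, not hidden)

B–U conclude from (3.9) with the NUMERICAL Table 1 (`I⁽²⁾ = 1.393`, `Ĩ⁽²⁾ = 0.6468`); at
`-J⁽²⁾/J⁽¹⁾ = 0.109` the margin in (3.9) is `6·10⁻⁴`, beyond any analytic majorant. We use only
their SECOND lower bound together with the polarised-state variational bound (the ingredient of
their (3.10)), which needs the single input `Ĩ⁽²⁾ < 2/√((3 + 2ρ)² - 1) = 0.6538…` at `ρ = 0.109`,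
supplied by `XYZGroundStateOrderIntegral.lean` (`Ĩ⁽²⁾ ≤ 0.6498`). The first lower bound of
Theorem 3.2 (with `I⁽²⁾`) is not needed.

## References

* [BjornbergUeltschi2022] J. E. Björnberg, D. Ueltschi, in: The Physics and Mathematics of
  Elliott Lieb, vol. I, EMS Press (2022) 77–108 = arXiv:2204.12896: Thm. 3.2, (3.8)–(3.10),
  Lemma 4.4, (4.26)–(4.42), Prop. 2.4, Lemma A.1.
* [KLS1988JSP] T. Kennedy, E. H. Lieb, B. S. Shastry, J. Stat. Phys. 53 (1988) 1019–1030.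
* [KLS1988PRL] T. Kennedy, E. H. Lieb, B. S. Shastry, Phys. Rev. Lett. 61 (1988) 2582–2584.
* [KuboKishi1988] K. Kubo, T. Kishi, Phys. Rev. Lett. 61 (1988) 2585.
-/

noncomputable section

open Matrix Finset Filter Topology
open scoped ComplexOrder
open Literature.MathematicalPhysics.QuantumLattice Literature.MathematicalPhysics.QuantumLattice.SpinOperators
  Literature.Probability.LatticeModels

namespace Literature.MathematicalPhysics.QuantumLattice

variable {d : ℕ}

-- Mathlib idiom (as in `Mathlib.Algebra.Lie.OfAssociative`): the commutator Lie-ring structure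
-- `⁅a, b⁆ = ab - ba` of an associative ring, enabled locally.
attribute [local instance 100] LieRing.ofAssociativeRing

/-! ### Nearest-neighbour sums on the torus of side `L ≥ 3` -/

section TorusSums

variable {L : ℕ} [NeZero L]

/-- For `L ≥ 3`, the neighbours of `x` in the torus graph are the `2d` distinct points `x ± eᵢ`:
`Σ_{y ∼ x} g(y) = Σᵢ (g(x + eᵢ) + g(x - eᵢ))` for any additive-monoid-valued `g` (the tree's
`sum_ite_torusGraph_adj` of `HubbardFreePropagator.lean`, there for complex-valued `g`).
Friedli–Velenik 2017, §3.1. [folklore] -/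
theorem sum_ite_torusGraph_adj' {M : Type*} [AddCommMonoid M] (hL : 3 ≤ L) (x : TorusSite d L)
    (g : TorusSite d L → M) :
    (∑ y, if (torusGraph d L).Adj x y then g y else 0) =
      ∑ i, (g (x + Pi.single i 1) + g (x - Pi.single i 1)) := by
  classical
  haveI : Fact (1 < L) := ⟨by omega⟩
  have h1 : (1 : ZMod L) ≠ 0 := one_ne_zero
  have h2 : (1 : ZMod L) + 1 ≠ 0 := by
    intro h
    have : ((2 : ℕ) : ZMod L) = 0 := by exact_mod_cast (by simpa [one_add_one_eq_two] using h)
    rw [ZMod.natCast_eq_zero_iff] at this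
    exact absurd (Nat.le_of_dvd two_pos this) (by omega)
  have hsingle_ne : ∀ i : Fin d, (Pi.single i 1 : TorusSite d L) ≠ 0 := fun i h => by
    have := congrFun h i; simp [h1] at this
  have hsingle_inj : ∀ i j : Fin d, (Pi.single i 1 : TorusSite d L) = Pi.single j 1 → i = j := by
    intro i j h
    by_contra hij
    have := congrFun h i
    simp [hij, h1] at this
  have hsum_ne : ∀ i j : Fin d, (Pi.single i 1 : TorusSite d L) + Pi.single j 1 ≠ 0 := by
    intro i j h
    have := congrFun h i
    by_cases hij : i = j
    · subst hij; simp [h2] at this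
    · simp [Ne.symm hij, h1] at this
  set Np : Finset (TorusSite d L) := univ.image fun i => x + Pi.single i 1 with hNp
  set Nm : Finset (TorusSite d L) := univ.image fun i => x - Pi.single i 1 with hNm
  have hadj : ∀ y, (torusGraph d L).Adj x y ↔ y ∈ Np ∪ Nm := by
    intro y
    rw [torusGraph_adj_iff, Finset.mem_union, Finset.mem_image, Finset.mem_image]
    constructor
    · rintro ⟨-, ⟨i, hi⟩ | ⟨i, hi⟩⟩
      · exact Or.inl ⟨i, mem_univ _, hi.symm⟩
      · exact Or.inr ⟨i, mem_univ _, by rw [hi, add_sub_cancel_right]⟩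
    · rintro (⟨i, -, hi⟩ | ⟨i, -, hi⟩)
      · refine ⟨fun hxy => hsingle_ne i ?_, Or.inl ⟨i, hi.symm⟩⟩
        have := hi; rw [← hxy] at this; simpa using this.symm
      · refine ⟨fun hxy => hsingle_ne i ?_, Or.inr ⟨i, by rw [← hi, sub_add_cancel]⟩⟩
        have := hi; rw [← hxy, sub_eq_self] at this; exact this
  have hdisj : Disjoint Np Nm := by
    rw [Finset.disjoint_left]
    intro y hp hm
    rw [hNp, Finset.mem_image] at hp
    rw [hNm, Finset.mem_image] at hm
    obtain ⟨i, -, rfl⟩ := hp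
    obtain ⟨j, -, hj⟩ := hm
    apply hsum_ne i j
    have := hj
    rw [sub_eq_iff_eq_add, add_assoc, left_eq_add] at this
    exact this
  have hinjp : Set.InjOn (fun i : Fin d => x + Pi.single i 1) (univ : Finset (Fin d)) :=
    fun i _ j _ h => hsingle_inj i j (add_left_cancel h)
  have hinjm : Set.InjOn (fun i : Fin d => x - Pi.single i 1) (univ : Finset (Fin d)) :=
    fun i _ j _ h => hsingle_inj i j (sub_right_injective h)
  calc (∑ y, if (torusGraph d L).Adj x y then g y else 0)
      = ∑ y, if y ∈ Np ∪ Nm then g y else 0 := by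
        refine Finset.sum_congr rfl fun y _ => ?_
        simp only [hadj]
    _ = ∑ y ∈ Np ∪ Nm, g y := by rw [Finset.sum_ite_mem, Finset.univ_inter]
    _ = ∑ y ∈ Np, g y + ∑ y ∈ Nm, g y := Finset.sum_union hdisj
    _ = ∑ i, g (x + Pi.single i 1) + ∑ i, g (x - Pi.single i 1) := by
        rw [hNp, hNm, Finset.sum_image hinjp, Finset.sum_image hinjm]
    _ = ∑ i, (g (x + Pi.single i 1) + g (x - Pi.single i 1)) := (Finset.sum_add_distrib).symm

/-- **Ordered adjacent pairs are twice the bonds `(x, x + eᵢ)`**: for `L ≥ 3` and a kernel that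
is symmetric on adjacent pairs, `Σ_x Σ_{y ∼ x} F(x,y) = 2 Σ_x Σᵢ F(x, x + eᵢ)`. [folklore] -/
theorem sum_sum_ite_torusGraph_adj {M : Type*} [AddCommMonoid M] (hL : 3 ≤ L)
    (F : TorusSite d L → TorusSite d L → M)
    (hF : ∀ x y, (torusGraph d L).Adj x y → F x y = F y x) :
    (∑ x, ∑ y, if (torusGraph d L).Adj x y then F x y else 0) =
      2 • ∑ x : TorusSite d L, ∑ i : Fin d, F x (x + Pi.single i 1) := by
  have hL2 : 2 ≤ L := by omega
  have hkey : ∀ x : TorusSite d L, (∑ y, if (torusGraph d L).Adj x y then F x y else 0) =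
      ∑ i, (F x (x + Pi.single i 1) + F x (x - Pi.single i 1)) := fun x =>
    sum_ite_torusGraph_adj' hL x (F x)
  simp_rw [hkey, sum_add_distrib]
  rw [two_nsmul]
  congr 1
  rw [sum_comm]
  conv_rhs => rw [sum_comm]
  refine sum_congr rfl fun i _ => ?_
  refine (Fintype.sum_equiv (Equiv.addRight (Pi.single i (1 : ZMod L)))
    (fun x => F x (x + Pi.single i 1)) (fun x => F x (x - Pi.single i 1)) fun x => ?_).symm
  simp only [Equiv.coe_addRight, add_sub_cancel_right]
  exact hF _ _ (torusGraph_adj_add_single L hL2 x i)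

end TorusSums

/-! ### The anisotropic Hamiltonian: Hermiticity, pair form -/

section Model

variable (L : ℕ) [NeZero L] (n : ℕ)

/-- The summand of `anisotropicTorus`: `a S⁰_xS⁰_y + b S¹_xS¹_y + c S²_xS²_y`. [folklore] -/
theorem anisotropicTorus_eq (a b c : ℝ) :
    anisotropicTorus d L n a b c = -∑ x : TorusSite d L, ∑ y : TorusSite d L,
      if (torusGraph d L).Adj x y then
        (a : ℂ) • (siteSpin n x 0 * siteSpin n y 0) + (b : ℂ) • (siteSpin n x 1 * siteSpin n y 1) +
          (c : ℂ) • (siteSpin n x 2 * siteSpin n y 2)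
      else 0 := rfl

/-- On an adjacent (hence distinct) pair the summand is a combination of the symmetrised bond
operators: `a S⁰S⁰ + b S¹S¹ + c S²S² = a·spinBond 0 + b·spinBond 1 + c·spinBond 2`. [folklore] -/
theorem anisotropic_summand_eq_spinBond {x y : TorusSite d L} (hxy : x ≠ y) (a b c : ℝ) :
    (a : ℂ) • (siteSpin n x 0 * siteSpin n y 0) + (b : ℂ) • (siteSpin n x 1 * siteSpin n y 1) +
        (c : ℂ) • (siteSpin n x 2 * siteSpin n y 2) =
      ((a : ℂ) • spinBond n 0 x y + (b : ℂ) • spinBond n 1 x y + (c : ℂ) • spinBond n 2 x y :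
        Op (TorusSite d L) (n + 1)) := by
  rw [spinBond_eq_mul_of_ne hxy, spinBond_eq_mul_of_ne hxy, spinBond_eq_mul_of_ne hxy]

/-- `anisotropicTorus` is Hermitian (real couplings, Hermitian bond operators). [folklore] -/
theorem anisotropicTorus_isHermitian (a b c : ℝ) : (anisotropicTorus d L n a b c).IsHermitian := by
  rw [anisotropicTorus_eq]
  refine IsHermitian.neg ?_
  refine (isSelfAdjoint_sum _ fun x _ => isSelfAdjoint_sum _ fun y _ => ?_).isHermitian
  split_ifs with h
  · have hxy : x ≠ y := (torusGraph d L).ne_of_adj h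
    rw [anisotropic_summand_eq_spinBond L n hxy]
    refine Matrix.IsHermitian.isSelfAdjoint ?_
    refine ((IsHermitian.smul (spinBond_isHermitian n 0 x y) ?_).add
      (IsHermitian.smul (spinBond_isHermitian n 1 x y) ?_)).add
      (IsHermitian.smul (spinBond_isHermitian n 2 x y) ?_) <;>
    rw [isSelfAdjoint_iff, Complex.star_def, Complex.conj_ofReal]
  · exact IsSelfAdjoint.zero _

/-- **Pair form of the anisotropic Hamiltonian** (`L ≥ 3`):
`H(a,b,c) = -2 Σ_x Σᵢ (a·spinBond 0 + b·spinBond 1 + c·spinBond 2)(x, x + eᵢ)` (each bond of the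
torus is counted twice in B–U's ordered-pair sum (2.4)). [cite: BjornbergUeltschi2022, eq. (2.4)] -/
theorem anisotropicTorus_eq_pairSum (hL : 3 ≤ L) (a b c : ℝ) :
    anisotropicTorus d L n a b c = -(2 • ∑ x : TorusSite d L, ∑ i : Fin d,
      ((a : ℂ) • spinBond n 0 x (x + Pi.single i 1) + (b : ℂ) • spinBond n 1 x (x + Pi.single i 1) +
        (c : ℂ) • spinBond n 2 x (x + Pi.single i 1))) := by
  have hL2 : 2 ≤ L := by omega
  rw [anisotropicTorus_eq]
  rw [neg_inj]
  have h1 : (∑ x : TorusSite d L, ∑ y : TorusSite d L,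
      if (torusGraph d L).Adj x y then
        (a : ℂ) • (siteSpin n x 0 * siteSpin n y 0) + (b : ℂ) • (siteSpin n x 1 * siteSpin n y 1) +
          (c : ℂ) • (siteSpin n x 2 * siteSpin n y 2)
      else (0 : Op (TorusSite d L) (n + 1))) =
      ∑ x : TorusSite d L, ∑ y : TorusSite d L, if (torusGraph d L).Adj x y then
        ((a : ℂ) • spinBond n 0 x y + (b : ℂ) • spinBond n 1 x y + (c : ℂ) • spinBond n 2 x y)
      else 0 := by
    refine sum_congr rfl fun x _ => sum_congr rfl fun y _ => ?_
    split_ifs with h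
    · exact anisotropic_summand_eq_spinBond L n ((torusGraph d L).ne_of_adj h) a b c
    · rfl
  rw [h1, sum_sum_ite_torusGraph_adj hL]
  intro x y _
  simp only [spinBond_comm]

end Model

/-! ### The objects: ground-state correlations of the rotated Hamiltonian `H' = H(1, J₂, J₁)` -/

section Objects

/-- The ground-state `α–α` correlation `Gᵅ_L(x,y) = Re ω(Sᵅ_x Sᵅ_y)` in the tracial ground state
of the rotated anisotropic Hamiltonian `H' = anisotropicTorus d L n 1 J₂ J₁` (coupling `1` on the
first component, `J₂ ≤ 0` on the second, `J₁` on the third; junk `0` at `L = 0`). For `α = 0`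
this is B–U's `⟨S⁽³⁾_x S⁽³⁾_y⟩` at `β = ∞`. [cite: BjornbergUeltschi2022, §2 (2.9) and Thm. 3.2] -/
def xyzGroundCorr (α : Fin 3) (L n : ℕ) (J₁ J₂ : ℝ) (x y : TorusSite d L) : ℝ :=
  if hL : L = 0 then 0
  else
    haveI : NeZero L := ⟨hL⟩
    ((anisotropicTorus d L n 1 J₂ J₁).groundStateFunctional (siteSpin n x α * siteSpin n y α)).re

/-- The ground-state structure factor of the first component,
`ĝ⁰_q = |Λ|⁻¹ Σ_{x,y} cos(q·(x-y)) G⁰(x,y)` (B–U (4.23) at `β = ∞`: `ℓ⁻ᵈ⟨Ŝ_{-k}Ŝ_k⟩`); junk `0`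
at `L = 0`. [cite: BjornbergUeltschi2022, eq. (4.23)] -/
def xyzStructureFactor (L n : ℕ) (J₁ J₂ : ℝ) (k : TorusSite d L) : ℝ :=
  if hL : L = 0 then 0
  else
    haveI : NeZero L := ⟨hL⟩
    (∑ x : TorusSite d L, ∑ y : TorusSite d L,
        Real.cos (torusPhase L k (x - y)) * xyzGroundCorr 0 L n J₁ J₂ x y) / (L : ℝ) ^ d

/-- The nearest-neighbour ground-state correlation of component `α`, averaged over sites and
directions: `cᵅ = (d L^d)⁻¹ Σ_x Σᵢ Gᵅ(x, x + eᵢ)` (B–U's `⟨S_0 S_{e₁}⟩`, (3.8), (4.34), which by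
the lattice symmetries does not depend on the direction). Junk `0` at `L = 0` or `d = 0`.
[cite: BjornbergUeltschi2022, eq. (3.8)] -/
def xyzBondCorr (α : Fin 3) (L n : ℕ) (J₁ J₂ : ℝ) : ℝ :=
  if hL : L = 0 then 0
  else
    haveI : NeZero L := ⟨hL⟩
    (∑ x : TorusSite d L, ∑ i : Fin d, xyzGroundCorr α L n J₁ J₂ x (x + Pi.single i 1)) /
      ((d : ℝ) * (L : ℝ) ^ d)

variable (L : ℕ) [NeZero L] (n : ℕ) (J₁ J₂ : ℝ)

/-- Unfolding on a genuine torus. [folklore] -/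
theorem xyzGroundCorr_of_neZero (α : Fin 3) (x y : TorusSite d L) :
    xyzGroundCorr α L n J₁ J₂ x y =
      ((anisotropicTorus d L n 1 J₂ J₁).groundStateFunctional (siteSpin n x α * siteSpin n y α)).re := by
  simp [xyzGroundCorr, NeZero.ne L]

/-- Unfolding the structure factor on a genuine torus. [folklore] -/
theorem xyzStructureFactor_of_neZero (k : TorusSite d L) :
    xyzStructureFactor L n J₁ J₂ k =
      (∑ x : TorusSite d L, ∑ y : TorusSite d L,
        Real.cos (torusPhase L k (x - y)) * xyzGroundCorr 0 L n J₁ J₂ x y) / (L : ℝ) ^ d := by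
  simp [xyzStructureFactor, NeZero.ne L]

/-- Unfolding the bond correlation on a genuine torus. [folklore] -/
theorem xyzBondCorr_of_neZero (α : Fin 3) :
    xyzBondCorr (d := d) α L n J₁ J₂ =
      (∑ x : TorusSite d L, ∑ i : Fin d, xyzGroundCorr α L n J₁ J₂ x (x + Pi.single i 1)) /
        ((d : ℝ) * (L : ℝ) ^ d) := by
  simp [xyzBondCorr, NeZero.ne L]

/-- The two-point function is symmetric: `Gᵅ(x,y) = Gᵅ(y,x)`. [folklore] -/
theorem xyzGroundCorr_symm (α : Fin 3) (x y : TorusSite d L) :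
    xyzGroundCorr α L n J₁ J₂ x y = xyzGroundCorr α L n J₁ J₂ y x := by
  rw [xyzGroundCorr_of_neZero, xyzGroundCorr_of_neZero]
  have h : siteSpin n y α * siteSpin n x α = (siteSpin n x α * siteSpin n y α)ᴴ := by
    rw [conjTranspose_mul, (siteSpin_isHermitian n x α).eq, (siteSpin_isHermitian n y α).eq]
  rw [h, groundStateFunctional_conjTranspose_re]

/-- A priori bound `|Gᵅ(x,y)| ≤ S²` (`S = n/2`; states have norm one). [folklore] -/
theorem xyzGroundCorr_abs_le (α : Fin 3) (x y : TorusSite d L) :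
    |xyzGroundCorr α L n J₁ J₂ x y| ≤ ((n : ℝ) / 2) ^ 2 := by
  rw [xyzGroundCorr_of_neZero]
  exact abs_re_groundStateFunctional_siteSpin_mul_le (anisotropicTorus_isHermitian L n 1 J₂ J₁) α x y

/-- Real part of `ω` on a symmetrised bond: `Re ω(spinBond α x y) = Gᵅ(x,y)`. [folklore] -/
theorem re_groundStateFunctional_xyz_spinBond (α : Fin 3) (x y : TorusSite d L) :
    ((anisotropicTorus d L n 1 J₂ J₁).groundStateFunctional (spinBond n α x y)).re =
      xyzGroundCorr α L n J₁ J₂ x y := by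
  rw [spinBond, LinearMap.map_smul, map_add, smul_eq_mul,
    show (1 / 2 : ℂ) = ((1 / 2 : ℝ) : ℂ) by push_cast; ring, Complex.re_ofReal_mul,
    Complex.add_re, ← xyzGroundCorr_of_neZero, ← xyzGroundCorr_of_neZero,
    xyzGroundCorr_symm L n J₁ J₂ α y x]
  ring

/-- At zero momentum the structure factor is the volume average of the two-point function.
[folklore] -/
theorem xyzStructureFactor_zero :
    xyzStructureFactor L n J₁ J₂ (0 : TorusSite d L) =
      (∑ x : TorusSite d L, ∑ y : TorusSite d L, xyzGroundCorr 0 L n J₁ J₂ x y) / (L : ℝ) ^ d := by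
  simp [xyzStructureFactor_of_neZero]

/-- **(E) The energy of a coupling triple in the ground state of `H'`** (`L ≥ 3`, `d ≥ 1`):
`Re ω(H(a,b,c)) = -2 d L^d (a c⁰ + b c¹ + c c²)`. [cite: BjornbergUeltschi2022, (2.4), (3.8)] -/
theorem re_groundStateFunctional_anisotropicTorus (hL : 3 ≤ L) (hd : 0 < d) (a b c : ℝ) :
    ((anisotropicTorus d L n 1 J₂ J₁).groundStateFunctional (anisotropicTorus d L n a b c)).re =
      -(2 * d * (L : ℝ) ^ d * (a * xyzBondCorr (d := d) 0 L n J₁ J₂ +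
        b * xyzBondCorr (d := d) 1 L n J₁ J₂ + c * xyzBondCorr (d := d) 2 L n J₁ J₂)) := by
  have hdL : (d : ℝ) * (L : ℝ) ^ d ≠ 0 := by
    have : (0 : ℝ) < L := by exact_mod_cast Nat.pos_of_ne_zero (NeZero.ne L)
    positivity
  set ω := (anisotropicTorus d L n 1 J₂ J₁).groundStateFunctional with hω
  have hterm : ∀ (x : TorusSite d L) (i : Fin d),
      (ω ((a : ℂ) • spinBond n 0 x (x + Pi.single i 1) + (b : ℂ) • spinBond n 1 x (x + Pi.single i 1) +
        (c : ℂ) • spinBond n 2 x (x + Pi.single i 1))).re =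
      a * xyzGroundCorr 0 L n J₁ J₂ x (x + Pi.single i 1) +
        b * xyzGroundCorr 1 L n J₁ J₂ x (x + Pi.single i 1) +
        c * xyzGroundCorr 2 L n J₁ J₂ x (x + Pi.single i 1) := by
    intro x i
    simp only [hω, map_add, LinearMap.map_smul, smul_eq_mul, Complex.add_re, Complex.re_ofReal_mul,
      re_groundStateFunctional_xyz_spinBond]
  rw [anisotropicTorus_eq_pairSum L n hL a b c, map_neg, map_nsmul, two_nsmul, Complex.neg_re,
    Complex.add_re, map_sum, Complex.re_sum]
  simp only [map_sum, Complex.re_sum, hterm]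
  rw [xyzBondCorr_of_neZero, xyzBondCorr_of_neZero, xyzBondCorr_of_neZero]
  simp only [sum_add_distrib, ← mul_sum]
  field_simp
  ring

/-- The ground energy of `H'` through the bond correlations: `E₀(H') = -2dL^d(c⁰ + J₂c¹ + J₁c²)`.
[cite: BjornbergUeltschi2022, (2.6) (`β → ∞`: "a trace in the eigenspace with lowest eigenvalue")] -/
theorem groundEnergy_anisotropicTorus_eq (hL : 3 ≤ L) (hd : 0 < d) :
    (anisotropicTorus d L n 1 J₂ J₁).groundEnergy =
      -(2 * d * (L : ℝ) ^ d * (xyzBondCorr (d := d) 0 L n J₁ J₂ +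
        J₂ * xyzBondCorr (d := d) 1 L n J₁ J₂ + J₁ * xyzBondCorr (d := d) 2 L n J₁ J₂)) := by
  have h := congrArg Complex.re
    (groundStateFunctional_hamiltonian (anisotropicTorus_isHermitian L n 1 J₂ J₁ (d := d)))
  rw [Complex.ofReal_re, re_groundStateFunctional_anisotropicTorus L n J₁ J₂ hL hd] at h
  rw [← h]
  ring

end Objects

/-! ### (C) The sum rule -/

section SumRule

/-- **(C) The sum rule** (finite-volume Parseval form of B–U (4.38), KLS eq. (3)):
`|Λ|⁻¹ Σ_q ĝ⁰_q (d⁻¹ Σᵢ cos qᵢ) = c⁰`, by orthogonality of the characters of `(ℤ/Lℤ)^d`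
(`sum_structureFactor_mul_cos`) and the symmetry of the two-point function.
[cite: BjornbergUeltschi2022, eq. (4.38)] -/
theorem xyz_structureFactor_sumRule (hd : 1 ≤ d) (L : ℕ) [NeZero L] (n : ℕ) (J₁ J₂ : ℝ) :
    (∑ q : TorusSite d L, xyzStructureFactor L n J₁ J₂ q * (torusCosSum L q / d)) / (L : ℝ) ^ d =
      xyzBondCorr (d := d) 0 L n J₁ J₂ := by
  have hd0 : (d : ℝ) ≠ 0 := by exact_mod_cast (show d ≠ 0 by omega)
  have hL0 : (L : ℝ) ^ d ≠ 0 := by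
    have : (L : ℝ) ≠ 0 := by exact_mod_cast NeZero.ne L
    positivity
  simp_rw [xyzStructureFactor_of_neZero, torusCosSum, xyzBondCorr_of_neZero]
  have h : ∀ q : TorusSite d L,
      (∑ x : TorusSite d L, ∑ y : TorusSite d L,
          Real.cos (torusPhase L q (x - y)) * xyzGroundCorr 0 L n J₁ J₂ x y) / (L : ℝ) ^ d *
        ((∑ i : Fin d, Real.cos (latticeMomentum L q i)) / d) =
      (∑ i : Fin d, (∑ x : TorusSite d L, ∑ y : TorusSite d L,
          Real.cos (torusPhase L q (x - y)) * xyzGroundCorr 0 L n J₁ J₂ x y) *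
        Real.cos (latticeMomentum L q i)) / ((d : ℝ) * (L : ℝ) ^ d) := by
    intro q
    rw [div_mul_div_comm, mul_sum, mul_comm ((L : ℝ) ^ d) (d : ℝ)]
  simp_rw [h]
  rw [← sum_div, sum_comm]
  simp_rw [sum_structureFactor_mul_cos L (xyzGroundCorr 0 L n J₁ J₂) (xyzGroundCorr_symm L n J₁ J₂ 0)]
  rw [← mul_sum, sum_comm]
  field_simp

end SumRule

/-! ### Single-site rotations: the quarter turn about the `1`-axis and its square -/

section SiteRotations

variable (n : ℕ)

/-- **The quarter turn about the `1`-axis** `R = V D Vᴴ` (`V` the quarter turn about the `2`-axis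
with `V Sᶻ Vᴴ = Sˣ`, `D` the quarter turn about the `3`-axis): a unitary with `R Sˣ Rᴴ = Sˣ`,
`R Sʸ Rᴴ = -Sᶻ`, `R Sᶻ Rᴴ = Sʸ`; its square `R²` (the rotation by `π` about the `1`-axis) has
`R² Sˣ R²ᴴ = Sˣ`, `R² Sʸ R²ᴴ = -Sʸ`, `R² Sᶻ R²ᴴ = -Sᶻ`. These are the single-site ingredients of
B–U's Prop. 2.4 ("by combining rotations by an angle `π/2` … and by an angle `π`").
[cite: BjornbergUeltschi2022, Prop. 2.4] -/
theorem exists_quarterTurn_x :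
    ∃ R : Matrix (Fin (n + 1)) (Fin (n + 1)) ℂ, R * Rᴴ = 1 ∧ Rᴴ * R = 1 ∧
      R * spinX n * Rᴴ = spinX n ∧ R * spinY n * Rᴴ = -SpinOperators.spinZ n ∧
      R * SpinOperators.spinZ n * Rᴴ = spinY n := by
  obtain ⟨V, hV, hV', hVz, hVx, hVy⟩ := exists_unitary_conj_spinZ_eq_spinX n
  obtain ⟨D, hD, hD', hDx, hDy, hDz⟩ := exists_unitary_conj_spinX_eq_neg_spinY n
  refine ⟨V * D * Vᴴ, ?_, ?_, ?_, ?_, ?_⟩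
  · rw [conjTranspose_mul, conjTranspose_mul, conjTranspose_conjTranspose]
    calc V * D * Vᴴ * (V * (Dᴴ * Vᴴ)) = V * (D * (Vᴴ * V) * Dᴴ) * Vᴴ := by
          simp only [Matrix.mul_assoc]
      _ = 1 := by rw [hV', Matrix.mul_one, hD, Matrix.mul_one, hV]
  · rw [conjTranspose_mul, conjTranspose_mul, conjTranspose_conjTranspose]
    calc V * (Dᴴ * Vᴴ) * (V * D * Vᴴ) = V * (Dᴴ * (Vᴴ * V) * D) * Vᴴ := by
          simp only [Matrix.mul_assoc]
      _ = 1 := by rw [hV', Matrix.mul_one, hD', Matrix.mul_one, hV]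
  · -- `Vᴴ Sˣ V = Sᶻ`, `D Sᶻ Dᴴ = Sᶻ`, `V Sᶻ Vᴴ = Sˣ`
    have h1 : Vᴴ * spinX n * V = SpinOperators.spinZ n := by
      rw [← hVz]
      calc Vᴴ * (V * SpinOperators.spinZ n * Vᴴ) * V = (Vᴴ * V) * SpinOperators.spinZ n * (Vᴴ * V) := by
            simp only [Matrix.mul_assoc]
        _ = SpinOperators.spinZ n := by rw [hV', Matrix.one_mul, Matrix.mul_one]
    rw [conjTranspose_mul, conjTranspose_mul, conjTranspose_conjTranspose]
    calc V * D * Vᴴ * spinX n * (V * (Dᴴ * Vᴴ)) = V * (D * (Vᴴ * spinX n * V) * Dᴴ) * Vᴴ := by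
          simp only [Matrix.mul_assoc]
      _ = spinX n := by rw [h1, hDz, hVz]
  · have h1 : Vᴴ * spinY n * V = spinY n := by
      conv_lhs => rw [← hVy]
      calc Vᴴ * (V * spinY n * Vᴴ) * V = (Vᴴ * V) * spinY n * (Vᴴ * V) := by
            simp only [Matrix.mul_assoc]
        _ = spinY n := by rw [hV', Matrix.one_mul, Matrix.mul_one]
    rw [conjTranspose_mul, conjTranspose_mul, conjTranspose_conjTranspose]
    calc V * D * Vᴴ * spinY n * (V * (Dᴴ * Vᴴ)) = V * (D * (Vᴴ * spinY n * V) * Dᴴ) * Vᴴ := by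
          simp only [Matrix.mul_assoc]
      _ = -SpinOperators.spinZ n := by rw [h1, hDy, hVx]
  · have h1 : Vᴴ * SpinOperators.spinZ n * V = -spinX n := by
      have h2 : SpinOperators.spinZ n = -(V * spinX n * Vᴴ) := by rw [hVx, neg_neg]
      rw [h2, Matrix.mul_neg, Matrix.neg_mul]
      congr 1
      calc Vᴴ * (V * spinX n * Vᴴ) * V = (Vᴴ * V) * spinX n * (Vᴴ * V) := by
            simp only [Matrix.mul_assoc]
        _ = spinX n := by rw [hV', Matrix.one_mul, Matrix.mul_one]
    rw [conjTranspose_mul, conjTranspose_mul, conjTranspose_conjTranspose]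
    calc V * D * Vᴴ * SpinOperators.spinZ n * (V * (Dᴴ * Vᴴ)) =
        V * (D * (Vᴴ * SpinOperators.spinZ n * V) * Dᴴ) * Vᴴ := by simp only [Matrix.mul_assoc]
      _ = spinY n := by rw [h1, Matrix.mul_neg, Matrix.neg_mul, hDx, neg_neg, hVy]

/-- The rotation by `π` about the `1`-axis: a unitary `T` with `T Sˣ Tᴴ = Sˣ`, `T Sʸ Tᴴ = -Sʸ`,
`T Sᶻ Tᴴ = -Sᶻ`. [cite: BjornbergUeltschi2022, Prop. 2.4] -/
theorem exists_halfTurn_x :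
    ∃ T : Matrix (Fin (n + 1)) (Fin (n + 1)) ℂ, T * Tᴴ = 1 ∧ Tᴴ * T = 1 ∧
      T * spinX n * Tᴴ = spinX n ∧ T * spinY n * Tᴴ = -spinY n ∧
      T * SpinOperators.spinZ n * Tᴴ = -SpinOperators.spinZ n := by
  obtain ⟨R, hR, hR', hRx, hRy, hRz⟩ := exists_quarterTurn_x n
  refine ⟨R * R, ?_, ?_, ?_, ?_, ?_⟩
  · rw [conjTranspose_mul, Matrix.mul_assoc, ← Matrix.mul_assoc R Rᴴ, hR, Matrix.one_mul, hR]
  · rw [conjTranspose_mul, Matrix.mul_assoc, ← Matrix.mul_assoc Rᴴ R, hR', Matrix.one_mul, hR']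
  · rw [conjTranspose_mul, show R * R * spinX n * (Rᴴ * Rᴴ) = R * (R * spinX n * Rᴴ) * Rᴴ by
      simp only [Matrix.mul_assoc], hRx, hRx]
  · rw [conjTranspose_mul, show R * R * spinY n * (Rᴴ * Rᴴ) = R * (R * spinY n * Rᴴ) * Rᴴ by
      simp only [Matrix.mul_assoc], hRy, Matrix.mul_neg, Matrix.neg_mul, hRz]
  · rw [conjTranspose_mul, show R * R * SpinOperators.spinZ n * (Rᴴ * Rᴴ) =
      R * (R * SpinOperators.spinZ n * Rᴴ) * Rᴴ by simp only [Matrix.mul_assoc], hRz, hRy]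

end SiteRotations

/-! ### Conjugating the anisotropic Hamiltonian by product unitaries -/

section Conjugation

variable (L : ℕ) [NeZero L] (n : ℕ)

/-- **Product unitaries act factorwise on the anisotropic Hamiltonian**: with
`Tᵅ_x = onSite x (u_x Sᵅ u_xᴴ)`,
`(⨂u) H(a,b,c) (⨂u)ᴴ = -Σ_x Σ_{y∼x} (a T⁰_xT⁰_y + b T¹_xT¹_y + c T²_xT²_y)`.
Tasaki (2020) §2.2, eq. (2.2.13). [folklore] -/
theorem productOp_conj_anisotropicTorus {u : TorusSite d L → Matrix (Fin (n + 1)) (Fin (n + 1)) ℂ}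
    (hua : ∀ z, u z * (u z)ᴴ = 1) (hub : ∀ z, (u z)ᴴ * u z = 1) (a b c : ℝ) :
    productOp u * anisotropicTorus d L n a b c * (productOp u)ᴴ =
      -∑ x : TorusSite d L, ∑ y : TorusSite d L, if (torusGraph d L).Adj x y then
        (a : ℂ) • ((onSite x (u x * spinVec n 0 * (u x)ᴴ) : Op (TorusSite d L) (n + 1)) *
            onSite y (u y * spinVec n 0 * (u y)ᴴ)) +
          (b : ℂ) • ((onSite x (u x * spinVec n 1 * (u x)ᴴ) : Op (TorusSite d L) (n + 1)) *
            onSite y (u y * spinVec n 1 * (u y)ᴴ)) +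
          (c : ℂ) • ((onSite x (u x * spinVec n 2 * (u x)ᴴ) : Op (TorusSite d L) (n + 1)) *
            onSite y (u y * spinVec n 2 * (u y)ᴴ))
      else 0 := by
  set W := productOp u with hW
  rw [anisotropicTorus_eq, Matrix.mul_neg, Matrix.neg_mul, Finset.mul_sum, Finset.sum_mul]
  rw [neg_inj]
  refine sum_congr rfl fun x _ => ?_
  rw [Finset.mul_sum, Finset.sum_mul]
  refine sum_congr rfl fun y _ => ?_
  split_ifs with h
  · simp only [Matrix.mul_add, Matrix.add_mul, Matrix.mul_smul, Matrix.smul_mul, hW,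
      productOp_conj_mul hub, productOp_conj_siteSpin hua]
  · rw [Matrix.mul_zero, Matrix.zero_mul]

variable {L n}

/-- **Global rotations permute the couplings**: if a single-site unitary `v` maps
`Sᵅ ↦ ε_α S^{π α}` for signs `ε_α = ±1` with `(π 0, π 1, π 2) = (γ₀, γ₁, γ₂)`, then
`(⨂v) H(a,b,c) (⨂v)ᴴ = -ΣΣ(a S^{γ₀}S^{γ₀} + b S^{γ₁}S^{γ₁} + c S^{γ₂}S^{γ₂})`. Here in the form needed:
the signs cancel on every bond. [cite: BjornbergUeltschi2022, Prop. 2.4] -/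
theorem globalOp_conj_anisotropicTorus {v : Matrix (Fin (n + 1)) (Fin (n + 1)) ℂ}
    (hva : v * vᴴ = 1) (hvb : vᴴ * v = 1) {γ : Fin 3 → Fin 3} {ε : Fin 3 → ℂ}
    (hε : ∀ α, ε α * ε α = 1) (hv : ∀ α, v * spinVec n α * vᴴ = ε α • spinVec n (γ α)) (a b c : ℝ) :
    productOp (fun _ : TorusSite d L => v) * anisotropicTorus d L n a b c *
        (productOp (fun _ : TorusSite d L => v))ᴴ =
      -∑ x : TorusSite d L, ∑ y : TorusSite d L, if (torusGraph d L).Adj x y then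
        (a : ℂ) • (siteSpin n x (γ 0) * siteSpin n y (γ 0)) +
          (b : ℂ) • (siteSpin n x (γ 1) * siteSpin n y (γ 1)) +
          (c : ℂ) • (siteSpin n x (γ 2) * siteSpin n y (γ 2))
      else 0 := by
  rw [productOp_conj_anisotropicTorus L n (fun _ => hva) (fun _ => hvb)]
  rw [neg_inj]
  refine sum_congr rfl fun x _ => sum_congr rfl fun y _ => ?_
  split_ifs with h
  · have key : ∀ α : Fin 3, ((onSite x (v * spinVec n α * vᴴ) : Op (TorusSite d L) (n + 1)) *
        onSite y (v * spinVec n α * vᴴ)) = siteSpin n x (γ α) * siteSpin n y (γ α) := by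
      intro α
      rw [hv, onSite_smul', onSite_smul', smul_mul_smul_comm, hε, one_smul]
      rfl
    rw [key, key, key]
  · rfl

/-- The parity sign of the even torus alternates along every edge. [Dyson–Lieb–Simon 1978, §2
(the two sublattices)] [folklore] -/
theorem torusParity_sign_adj (k : ℕ) [NeZero (2 * k)] {x y : TorusSite d (2 * k)}
    (hxy : (torusGraph d (2 * k)).Adj x y) :
    (if (∑ j, ZMod.castHom (dvd_mul_right 2 k) (ZMod 2) (x j)) = 0 then (1 : ℂ) else -1) *
      (if (∑ j, ZMod.castHom (dvd_mul_right 2 k) (ZMod 2) (y j)) = 0 then (1 : ℂ) else -1) = -1 := by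
  set ε : TorusSite d (2 * k) → ZMod 2 := fun x =>
    ∑ j, ZMod.castHom (dvd_mul_right 2 k) (ZMod 2) (x j) with hε
  have h01 : ∀ t : ZMod 2, t = 0 ∨ t = 1 := by decide
  have key : ∀ x' : TorusSite d (2 * k), ∀ i,
      (if ε x' = 0 then (1 : ℂ) else -1) * (if ε (x' + Pi.single i 1) = 0 then (1 : ℂ) else -1) = -1 := by
    intro x' i
    have hpar : ε (x' + Pi.single i 1) = ε x' + 1 := torusParity_add_single k x' i
    simp only [hpar]
    rcases h01 (ε x') with h0 | h1
    · rw [if_pos h0, if_neg (by rw [h0]; decide), one_mul]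
    · rw [if_neg (by rw [h1]; decide), if_pos (by rw [h1]; decide), mul_one]
  rw [torusGraph_adj_iff] at hxy
  obtain ⟨-, ⟨i, rfl⟩ | ⟨i, rfl⟩⟩ := hxy
  · exact key x i
  · rw [mul_comm]; exact key y i

/-- **Sublattice rotations flip the sign of two couplings** (Dyson–Lieb–Simon 1978 §2; B–U Prop.
2.4, the `W_x` on odd sites): on the even torus, for a single-site unitary `t` with
`t Sˣ tᴴ = Sˣ`, `t Sʸ tᴴ = -Sʸ`, `t Sᶻ tᴴ = -Sᶻ` placed on the odd sublattice,
`U H(a,b,c) Uᴴ = H(a,-b,-c)`. [cite: BjornbergUeltschi2022, Prop. 2.4] -/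
theorem sublatticeOp_conj_anisotropicTorus (k : ℕ) [NeZero (2 * k)]
    {t : Matrix (Fin (n + 1)) (Fin (n + 1)) ℂ} (hta : t * tᴴ = 1) (htb : tᴴ * t = 1)
    (htx : t * spinX n * tᴴ = spinX n) (hty : t * spinY n * tᴴ = -spinY n)
    (htz : t * SpinOperators.spinZ n * tᴴ = -SpinOperators.spinZ n) (a b c : ℝ) :
    productOp (fun z : TorusSite d (2 * k) =>
        if (∑ j, ZMod.castHom (dvd_mul_right 2 k) (ZMod 2) (z j)) = 0 then (1 : Matrix _ _ ℂ) else t) *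
        anisotropicTorus d (2 * k) n a b c *
        (productOp (fun z : TorusSite d (2 * k) =>
          if (∑ j, ZMod.castHom (dvd_mul_right 2 k) (ZMod 2) (z j)) = 0 then (1 : Matrix _ _ ℂ) else t))ᴴ =
      anisotropicTorus d (2 * k) n a (-b) (-c) := by
  set u : TorusSite d (2 * k) → Matrix (Fin (n + 1)) (Fin (n + 1)) ℂ := fun z =>
    if (∑ j, ZMod.castHom (dvd_mul_right 2 k) (ZMod 2) (z j)) = 0 then 1 else t with hu
  set sgn : TorusSite d (2 * k) → ℂ := fun z =>
    if (∑ j, ZMod.castHom (dvd_mul_right 2 k) (ZMod 2) (z j)) = 0 then 1 else -1 with hsgn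
  have hua : ∀ z, u z * (u z)ᴴ = 1 := by
    intro z; simp only [hu]; split_ifs
    · rw [conjTranspose_one, Matrix.mul_one]
    · exact hta
  have hub : ∀ z, (u z)ᴴ * u z = 1 := by
    intro z; simp only [hu]; split_ifs
    · rw [conjTranspose_one, Matrix.mul_one]
    · exact htb
  have hux : ∀ z, u z * spinVec n 0 * (u z)ᴴ = spinVec n 0 := by
    intro z; simp only [hu, spinVec_zero]; split_ifs
    · rw [conjTranspose_one, Matrix.mul_one, Matrix.one_mul]
    · exact htx
  have huy : ∀ z, u z * spinVec n 1 * (u z)ᴴ = sgn z • spinVec n 1 := by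
    intro z; simp only [hu, hsgn, spinVec_one]; split_ifs
    · rw [conjTranspose_one, Matrix.mul_one, Matrix.one_mul, one_smul]
    · rw [hty, neg_one_smul]
  have huz : ∀ z, u z * spinVec n 2 * (u z)ᴴ = sgn z • spinVec n 2 := by
    intro z; simp only [hu, hsgn, spinVec_two]; split_ifs
    · rw [conjTranspose_one, Matrix.mul_one, Matrix.one_mul, one_smul]
    · rw [htz, neg_one_smul]
  rw [productOp_conj_anisotropicTorus (2 * k) n hua hub, anisotropicTorus_eq]
  rw [neg_inj]
  refine sum_congr rfl fun x _ => sum_congr rfl fun y _ => ?_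
  split_ifs with h
  · have hs : sgn x * sgn y = -1 := torusParity_sign_adj k h
    rw [hux, hux, huy, huy, huz, huz, onSite_smul', onSite_smul', onSite_smul', onSite_smul',
      smul_mul_smul_comm, smul_mul_smul_comm, hs]
    simp only [neg_smul, one_smul, smul_neg, Complex.ofReal_neg]
    rfl
  · rfl

end Conjugation

/-! ### (V), (O): the variational inequalities for the bond correlations of `H'` -/

section Variational

variable (L : ℕ) [NeZero L] (n : ℕ) (J₁ J₂ : ℝ)

/-- **The orbit comparison** ("otherwise the energy could be lowered", Kubo; B–U Prop. 2.4 with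
the variational principle): if `U H' Uᴴ = H(a,b,c)` for a unitary `U`, then
`a c⁰ + b c¹ + c c² ≤ c⁰ + J₂ c¹ + J₁ c²` (`E₀(H') = E₀(UH'Uᴴ) ≤ Re ω(H(a,b,c))`).
[cite: BjornbergUeltschi2022, Prop. 2.4] [cite: KLS1988PRL, after eq. (4)] -/
theorem xyz_orbit_le (hL : 3 ≤ L) (hd : 0 < d) {U : Op (TorusSite d L) (n + 1)}
    (hU : U * Uᴴ = 1) (a b c : ℝ)
    (hconj : U * anisotropicTorus d L n 1 J₂ J₁ * Uᴴ = anisotropicTorus d L n a b c) :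
    a * xyzBondCorr (d := d) 0 L n J₁ J₂ + b * xyzBondCorr (d := d) 1 L n J₁ J₂ +
        c * xyzBondCorr (d := d) 2 L n J₁ J₂ ≤
      xyzBondCorr (d := d) 0 L n J₁ J₂ + J₂ * xyzBondCorr (d := d) 1 L n J₁ J₂ +
        J₁ * xyzBondCorr (d := d) 2 L n J₁ J₂ := by
  have hHerm := anisotropicTorus_isHermitian L n 1 J₂ J₁ (d := d)
  have hUu : U ∈ Matrix.unitaryGroup (TensorIndex (TorusSite d L) (n + 1)) ℂ :=
    Matrix.mem_unitaryGroup_iff.2 hU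
  have h1 : (anisotropicTorus d L n 1 J₂ J₁).groundEnergy = (anisotropicTorus d L n a b c).groundEnergy := by
    rw [← hconj, Matrix.groundEnergy_unitary_conj hUu]
  have h2 := groundEnergy_le_groundStateFunctional_re hHerm (anisotropicTorus_isHermitian L n a b c (d := d))
  rw [← h1, groundEnergy_anisotropicTorus_eq L n J₁ J₂ hL hd,
    re_groundStateFunctional_anisotropicTorus L n J₁ J₂ hL hd] at h2
  have hpos : (0 : ℝ) < 2 * d * (L : ℝ) ^ d := by
    have : (0 : ℝ) < L := by exact_mod_cast Nat.pos_of_ne_zero (NeZero.ne L)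
    have : (0 : ℝ) < d := by exact_mod_cast hd
    positivity
  nlinarith

/-- **(O) The orbit inequalities for `H' = H(1, J₂, J₁)` on an even torus of side `2k ≥ 4`**:
(i) `(J₁ - J₂)(c² - c¹) ≥ 0` (quarter turn about `Sˣ`, `H ↦ H(1, J₁, J₂)`),
(ii) `J₂c¹ + J₁c² ≥ 0` (`π`-rotation about `Sˣ` on the odd sublattice, `H ↦ H(1, -J₂, -J₁)`),
(iii) `(J₁ + J₂)(c¹ + c²) ≥ 0` (their composite, `H ↦ H(1, -J₁, -J₂)`),
(iv) `(1 - J₁)(c⁰ - c²) ≥ 0` (`W = ⨂V`, `H ↦ H(J₁, J₂, 1)`).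
This is the content of B–U's Lemma A.1 (`|⟨S⁽²⁾S⁽²⁾⟩| ≤ ⟨S⁽¹⁾S⁽¹⁾⟩ ≤ ⟨S⁽³⁾S⁽³⁾⟩`, there by a
Trotter/positivity argument) in the averaged form the proof consumes, obtained instead by Kubo's
variational argument. [cite: BjornbergUeltschi2022, Lemma A.1 and Prop. 2.4]
[cite: KLS1988PRL, after eq. (4)] -/
theorem xyz_orbit_inequalities (hd : 0 < d) (k : ℕ) (hk : 2 ≤ k) :
    haveI : NeZero (2 * k) := ⟨by omega⟩
    0 ≤ (J₁ - J₂) * (xyzBondCorr (d := d) 2 (2 * k) n J₁ J₂ - xyzBondCorr (d := d) 1 (2 * k) n J₁ J₂) ∧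
    0 ≤ J₂ * xyzBondCorr (d := d) 1 (2 * k) n J₁ J₂ + J₁ * xyzBondCorr (d := d) 2 (2 * k) n J₁ J₂ ∧
    0 ≤ (J₁ + J₂) * (xyzBondCorr (d := d) 1 (2 * k) n J₁ J₂ + xyzBondCorr (d := d) 2 (2 * k) n J₁ J₂) ∧
    0 ≤ (1 - J₁) * (xyzBondCorr (d := d) 0 (2 * k) n J₁ J₂ - xyzBondCorr (d := d) 2 (2 * k) n J₁ J₂) := by
  haveI : NeZero (2 * k) := ⟨by omega⟩
  have hL : 3 ≤ 2 * k := by omega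
  set L := 2 * k with hLdef
  -- the single-site unitaries
  obtain ⟨V, hV, hV', hVz, hVx, hVy⟩ := exists_unitary_conj_spinZ_eq_spinX n
  obtain ⟨R, hR, hR', hRx, hRy, hRz⟩ := exists_quarterTurn_x n
  obtain ⟨T, hT, hT', hTx, hTy, hTz⟩ := exists_halfTurn_x n
  have hpm : ∀ s : ℂ, s = 1 ∨ s = -1 → s * s = 1 := by
    rintro s (rfl | rfl) <;> norm_num
  -- (i) the quarter turn about `Sˣ`: `H(a,b,c) ↦ H(a,c,b)`
  have hRconj : ∀ a b c : ℝ, productOp (fun _ : TorusSite d L => R) * anisotropicTorus d L n a b c *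
      (productOp (fun _ : TorusSite d L => R))ᴴ = anisotropicTorus d L n a c b := by
    intro a b c
    rw [globalOp_conj_anisotropicTorus hR hR' (γ := ![0, 2, 1]) (ε := ![1, -1, 1])
      (fun α => by fin_cases α <;> simp) (fun α => by
        fin_cases α
        · simpa using hRx
        · simpa using hRy
        · simpa using hRz) a b c, anisotropicTorus_eq]
    rw [neg_inj]
    refine sum_congr rfl fun x _ => sum_congr rfl fun y _ => ?_
    split_ifs
    · simp only [Matrix.cons_val_zero, Matrix.cons_val_one, Matrix.cons_val]
      abel
    · rfl
  have hRu : productOp (fun _ : TorusSite d L => R) * (productOp (fun _ : TorusSite d L => R))ᴴ = 1 :=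
    productOp_mul_conjTranspose fun _ => hR
  -- (ii) the sublattice half turn: `H(a,b,c) ↦ H(a,-b,-c)`
  set u : TorusSite d L → Matrix (Fin (n + 1)) (Fin (n + 1)) ℂ := fun z =>
    if (∑ j, ZMod.castHom (dvd_mul_right 2 k) (ZMod 2) (z j)) = 0 then 1 else T with hu
  have hTconj : ∀ a b c : ℝ, productOp u * anisotropicTorus d L n a b c * (productOp u)ᴴ =
      anisotropicTorus d L n a (-b) (-c) := fun a b c =>
    sublatticeOp_conj_anisotropicTorus k hT hT' hTx hTy hTz a b c
  have hua : ∀ z, u z * (u z)ᴴ = 1 := by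
    intro z; simp only [hu]; split_ifs
    · rw [conjTranspose_one, Matrix.mul_one]
    · exact hT
  have hTu : productOp u * (productOp u)ᴴ = 1 := productOp_mul_conjTranspose hua
  -- (iv) `W = ⨂V`: `H(a,b,c) ↦ H(c,b,a)`
  have hVconj : ∀ a b c : ℝ, productOp (fun _ : TorusSite d L => V) * anisotropicTorus d L n a b c *
      (productOp (fun _ : TorusSite d L => V))ᴴ = anisotropicTorus d L n c b a := by
    intro a b c
    rw [globalOp_conj_anisotropicTorus hV hV' (γ := ![2, 1, 0]) (ε := ![-1, 1, 1])
      (fun α => by fin_cases α <;> simp) (fun α => by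
        fin_cases α
        · simpa using hVx
        · simpa using hVy
        · simpa using hVz) a b c, anisotropicTorus_eq]
    rw [neg_inj]
    refine sum_congr rfl fun x _ => sum_congr rfl fun y _ => ?_
    split_ifs
    · simp only [Matrix.cons_val_zero, Matrix.cons_val_one, Matrix.cons_val]
      abel
    · rfl
  have hVu : productOp (fun _ : TorusSite d L => V) * (productOp (fun _ : TorusSite d L => V))ᴴ = 1 :=
    productOp_mul_conjTranspose fun _ => hV
  refine ⟨?_, ?_, ?_, ?_⟩
  · have h := xyz_orbit_le L n J₁ J₂ hL hd hRu 1 J₁ J₂ (hRconj 1 J₂ J₁)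
    nlinarith
  · have h := xyz_orbit_le L n J₁ J₂ hL hd hTu 1 (-J₂) (-J₁) (hTconj 1 J₂ J₁)
    nlinarith
  · -- composite: `(⨂R)(⨂u) H' ((⨂R)(⨂u))ᴴ = H(1, -J₁, -J₂)`
    have hcomp : productOp (fun _ : TorusSite d L => R) * productOp u * anisotropicTorus d L n 1 J₂ J₁ *
        (productOp (fun _ : TorusSite d L => R) * productOp u)ᴴ = anisotropicTorus d L n 1 (-J₁) (-J₂) := by
      rw [conjTranspose_mul, show productOp (fun _ : TorusSite d L => R) * productOp u *
        anisotropicTorus d L n 1 J₂ J₁ * ((productOp u)ᴴ * (productOp (fun _ : TorusSite d L => R))ᴴ) =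
        productOp (fun _ : TorusSite d L => R) * (productOp u * anisotropicTorus d L n 1 J₂ J₁ *
          (productOp u)ᴴ) * (productOp (fun _ : TorusSite d L => R))ᴴ by simp only [Matrix.mul_assoc],
        hTconj, hRconj]
    have hcu : productOp (fun _ : TorusSite d L => R) * productOp u *
        (productOp (fun _ : TorusSite d L => R) * productOp u)ᴴ = 1 := by
      rw [conjTranspose_mul, show productOp (fun _ : TorusSite d L => R) * productOp u *
        ((productOp u)ᴴ * (productOp (fun _ : TorusSite d L => R))ᴴ) =
        productOp (fun _ : TorusSite d L => R) * (productOp u * (productOp u)ᴴ) *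
          (productOp (fun _ : TorusSite d L => R))ᴴ by simp only [Matrix.mul_assoc], hTu, Matrix.mul_one, hRu]
    have h := xyz_orbit_le L n J₁ J₂ hL hd hcu 1 (-J₁) (-J₂) hcomp
    nlinarith
  · have h := xyz_orbit_le L n J₁ J₂ hL hd hVu J₁ J₂ 1 (hVconj 1 J₂ J₁)
    nlinarith

/-- **Symmetry at `J₁ = 1`**: `W = ⨂V` commutes with `H(1, J₂, 1)`, so `c⁰ = c²` (invariance of
the tracial ground state under symmetries, `groundStateFunctional_conj_of_commute`).
[cite: BjornbergUeltschi2022, Prop. 2.4] -/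
theorem xyzBondCorr_zero_eq_two_of_J₁_eq_one :
    xyzBondCorr (d := d) 0 L n 1 J₂ = xyzBondCorr (d := d) 2 L n 1 J₂ := by
  obtain ⟨V, hV, hV', hVz, hVx, hVy⟩ := exists_unitary_conj_spinZ_eq_spinX n
  set W : Op (TorusSite d L) (n + 1) := productOp (fun _ : TorusSite d L => V) with hW
  have hWW : Wᴴ * W = 1 := productOp_conjTranspose_mul fun _ => hV'
  have hWW' : W * Wᴴ = 1 := productOp_mul_conjTranspose fun _ => hV
  have hconj : W * anisotropicTorus d L n 1 J₂ 1 * Wᴴ = anisotropicTorus d L n 1 J₂ 1 := by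
    rw [hW, globalOp_conj_anisotropicTorus hV hV' (γ := ![2, 1, 0]) (ε := ![-1, 1, 1])
      (fun α => by fin_cases α <;> simp) (fun α => by
        fin_cases α
        · simpa using hVx
        · simpa using hVy
        · simpa using hVz) 1 J₂ 1, anisotropicTorus_eq]
    rw [neg_inj]
    refine sum_congr rfl fun x _ => sum_congr rfl fun y _ => ?_
    split_ifs
    · simp only [Matrix.cons_val_zero, Matrix.cons_val_one, Matrix.cons_val]
      abel
    · rfl
  have hcomm : W * anisotropicTorus d L n 1 J₂ 1 = anisotropicTorus d L n 1 J₂ 1 * W := by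
    calc W * anisotropicTorus d L n 1 J₂ 1 = W * anisotropicTorus d L n 1 J₂ 1 * (Wᴴ * W) := by
          rw [hWW, Matrix.mul_one]
      _ = anisotropicTorus d L n 1 J₂ 1 * W := by rw [← Matrix.mul_assoc, hconj]
  have hpt : ∀ x y : TorusSite d L, xyzGroundCorr 0 L n 1 J₂ x y = xyzGroundCorr 2 L n 1 J₂ x y := by
    intro x y
    rw [xyzGroundCorr_of_neZero, xyzGroundCorr_of_neZero]
    have hO : W * (siteSpin n x 2 * siteSpin n y 2) * Wᴴ = siteSpin n x 0 * siteSpin n y 0 := by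
      rw [hW, productOp_conj_mul (fun _ => hV'), productOp_conj_siteSpin (fun _ => hV),
        productOp_conj_siteSpin (fun _ => hV), spinVec_two, hVz]
      rfl
    rw [← hO, groundStateFunctional_conj_of_commute (anisotropicTorus_isHermitian L n 1 J₂ 1) hcomm hWW]
  rw [xyzBondCorr_of_neZero, xyzBondCorr_of_neZero]
  simp only [hpt]

/-- **(V) The polarised-state variational bound** (B–U (3.10)/Kubo–Kishi: "the variational
principle with the constant state"): `c⁰ + J₂c¹ + J₁c² ≥ S²` (`S = n/2`, `L ≥ 3`, `d ≥ 1`) — the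
basis state `|0…0⟩` (all spins up along `Sᶻ`) has `⟨H₀⟩ = -2d|Λ|S²` in the ORIGINAL frame
`H₀ = H(J₁, J₂, 1)`, which is unitarily equivalent to `H'`. [cite: BjornbergUeltschi2022, eq. (3.10)]
[cite: KuboKishi1988] -/
theorem xyz_polarised_bound (hL : 3 ≤ L) (hd : 0 < d) :
    ((n : ℝ) / 2) ^ 2 ≤ xyzBondCorr (d := d) 0 L n J₁ J₂ + J₂ * xyzBondCorr (d := d) 1 L n J₁ J₂ +
      J₁ * xyzBondCorr (d := d) 2 L n J₁ J₂ := by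
  set H₀ := anisotropicTorus d L n J₁ J₂ 1 with hH₀
  have hHerm₀ : H₀.IsHermitian := anisotropicTorus_isHermitian L n J₁ J₂ 1
  -- (1) `E₀(H') = E₀(H₀)`
  obtain ⟨V, hV, hV', hVz, hVx, hVy⟩ := exists_unitary_conj_spinZ_eq_spinX n
  set W : Op (TorusSite d L) (n + 1) := productOp (fun _ : TorusSite d L => V) with hW
  have hconj : W * H₀ * Wᴴ = anisotropicTorus d L n 1 J₂ J₁ := by
    rw [hW, hH₀, globalOp_conj_anisotropicTorus hV hV' (γ := ![2, 1, 0]) (ε := ![-1, 1, 1])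
      (fun α => by fin_cases α <;> simp) (fun α => by
        fin_cases α
        · simpa using hVx
        · simpa using hVy
        · simpa using hVz) J₁ J₂ 1, anisotropicTorus_eq]
    rw [neg_inj]
    refine sum_congr rfl fun x _ => sum_congr rfl fun y _ => ?_
    split_ifs
    · simp only [Matrix.cons_val_zero, Matrix.cons_val_one, Matrix.cons_val]
      abel
    · rfl
  have hWu : W ∈ Matrix.unitaryGroup (TensorIndex (TorusSite d L) (n + 1)) ℂ :=
    Matrix.mem_unitaryGroup_iff.2 (productOp_mul_conjTranspose fun _ => hV)
  have hE : (anisotropicTorus d L n 1 J₂ J₁).groundEnergy = H₀.groundEnergy := by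
    rw [← hconj, Matrix.groundEnergy_unitary_conj hWu]
  -- (2) the diagonal entry of `H₀` at the all-up configuration
  set σ₀ : TensorIndex (TorusSite d L) (n + 1) := fun _ => 0 with hσ₀
  have hdiag : H₀ σ₀ σ₀ = -((((n : ℝ) / 2) ^ 2 * (2 * d * (L : ℝ) ^ d) : ℝ) : ℂ) := by
    have hentry : ∀ x y : TorusSite d L, (torusGraph d L).Adj x y →
        ((J₁ : ℂ) • (siteSpin n x 0 * siteSpin n y 0) + (J₂ : ℂ) • (siteSpin n x 1 * siteSpin n y 1) +
          ((1 : ℝ) : ℂ) • (siteSpin n x 2 * siteSpin n y 2) : Op (TorusSite d L) (n + 1)) σ₀ σ₀ =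
          (((n : ℝ) / 2) ^ 2 : ℝ) := by
      intro x y hxy
      have hne : x ≠ y := (torusGraph d L).ne_of_adj hxy
      -- `⟨0| Sˣ |0⟩ = 0` (no diagonal entries; Tasaki (2020) §2.1, eq. (2.1.6))
      have hX0 : spinX n 0 0 = 0 := by
        rw [spinX, Matrix.smul_apply, Matrix.add_apply, spinLower_eq_conjTranspose, conjTranspose_apply,
          spinRaise_apply_self, star_zero, add_zero, smul_zero]
      simp only [Matrix.add_apply, Matrix.smul_apply, smul_eq_mul, siteSpin,
        onSite_mul_onSite_apply_self hne, hσ₀, spinVec_zero, spinVec_one, spinVec_two,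
        hX0, spinY_apply_zero_zero, spinZ_apply_zero_zero]
      push_cast
      ring
    rw [hH₀, anisotropicTorus_eq, Matrix.neg_apply]
    rw [neg_inj]
    rw [Matrix.sum_apply]
    simp_rw [Matrix.sum_apply]
    have h2 : (∑ x : TorusSite d L, ∑ y : TorusSite d L,
        (if (torusGraph d L).Adj x y then
          ((J₁ : ℂ) • (siteSpin n x 0 * siteSpin n y 0) + (J₂ : ℂ) • (siteSpin n x 1 * siteSpin n y 1) +
            ((1 : ℝ) : ℂ) • (siteSpin n x 2 * siteSpin n y 2) : Op (TorusSite d L) (n + 1))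
        else 0) σ₀ σ₀) =
        ∑ x : TorusSite d L, ∑ y : TorusSite d L,
          if (torusGraph d L).Adj x y then ((((n : ℝ) / 2) ^ 2 : ℝ) : ℂ) else 0 := by
      refine sum_congr rfl fun x _ => sum_congr rfl fun y _ => ?_
      split_ifs with h
      · exact hentry x y h
      · rfl
    rw [h2, sum_sum_ite_torusGraph_adj hL (fun _ _ => ((((n : ℝ) / 2) ^ 2 : ℝ) : ℂ)) (fun _ _ _ => rfl)]
    simp only [sum_const, card_univ, Fintype.card_fin, nsmul_eq_mul, Fintype.card_pi,
      prod_const, ZMod.card, Nat.cast_pow]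
    push_cast
    ring
  -- (3) the variational principle with the basis vector `e_{σ₀}`
  set v : TensorIndex (TorusSite d L) (n + 1) → ℂ := Pi.single σ₀ 1 with hv
  have hstar : star v = v := by rw [hv, ← Pi.single_star, star_one]
  have hψ : star v ⬝ᵥ v = 1 := by rw [hstar, hv, single_dotProduct, Pi.single_eq_same, one_mul]
  have h3 := groundEnergy_le_rayleigh_holds hHerm₀ v hψ
  rw [hstar, hv, single_dotProduct, one_mul, mulVec_single_one, Matrix.col_apply, hdiag,
    Complex.neg_re, Complex.ofReal_re, ← hE, groundEnergy_anisotropicTorus_eq L n J₁ J₂ hL hd] at h3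
  have hpos : (0 : ℝ) < 2 * d * (L : ℝ) ^ d := by
    have : (0 : ℝ) < L := by exact_mod_cast Nat.pos_of_ne_zero (NeZero.ne L)
    have : (0 : ℝ) < d := by exact_mod_cast hd
    positivity
  nlinarith

/-- **B–U (4.42)**: `(J₁ - J₂) c⁰ ≥ J₁ (J₂c¹ + J₁c²)` — in B–U's axes `⟨S⁽³⁾_0S⁽³⁾_{e₁}⟩ ≥
α/(1 - J⁽²⁾/J⁽¹⁾)` — on even tori of side `2k ≥ 4`, for `0 < J₁ ≤ 1`, `J₂ ≤ 0`, `-J₂ < J₁`: from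
the orbit inequalities, `c² ≥ |c¹| ≥ 0` and `c⁰ ≥ c²`. [cite: BjornbergUeltschi2022, eq. (4.42)] -/
theorem xyz_bu442 (hd : 0 < d) (k : ℕ) (hk : 2 ≤ k) (hJ₁ : 0 < J₁) (hJ₁' : J₁ ≤ 1) (hJ₂ : J₂ ≤ 0)
    (hJ : -J₂ < J₁) :
    haveI : NeZero (2 * k) := ⟨by omega⟩
    J₁ * (J₂ * xyzBondCorr (d := d) 1 (2 * k) n J₁ J₂ + J₁ * xyzBondCorr (d := d) 2 (2 * k) n J₁ J₂) ≤
      (J₁ - J₂) * xyzBondCorr (d := d) 0 (2 * k) n J₁ J₂ := by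
  haveI : NeZero (2 * k) := ⟨by omega⟩
  obtain ⟨h1, h2, h3, h4⟩ := xyz_orbit_inequalities n J₁ J₂ hd k hk
  set c0 := xyzBondCorr (d := d) 0 (2 * k) n J₁ J₂
  set c1 := xyzBondCorr (d := d) 1 (2 * k) n J₁ J₂
  set c2 := xyzBondCorr (d := d) 2 (2 * k) n J₁ J₂
  have h21 : c1 ≤ c2 := by nlinarith
  have h12 : -c1 ≤ c2 := by nlinarith
  -- `c⁰ ≥ c²`: from (iv) if `J₁ < 1`, by symmetry if `J₁ = 1`
  have h02 : c2 ≤ c0 := by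
    rcases hJ₁'.lt_or_eq with hlt | heq
    · nlinarith
    · have := xyzBondCorr_zero_eq_two_of_J₁_eq_one (2 * k) n J₂ (d := d)
      subst heq
      exact le_of_eq this.symm
  have hc2 : 0 ≤ c2 := by linarith
  nlinarith [mul_nonneg hJ₁.le hc2, mul_nonneg (neg_nonneg.2 hJ₂) hc2,
    mul_le_mul_of_nonneg_left h02 hJ₁.le, mul_le_mul_of_nonneg_left h02 (neg_nonneg.2 hJ₂)]

end Variational

/-! ### (A) The double commutator of `H'` with a wave of the first component (B–U (4.27)–(4.28)) -/

section DoubleCommutator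

variable {Λ : Type*} [Fintype Λ] [DecidableEq Λ] {n : ℕ}

/-- `[S⁰_xS⁰_y, A] = 0` for a wave `A = Σ_u a_u S⁰_u` of the same component. [folklore] -/
theorem lie_xxbond_wave_eq_zero (a : Λ → ℂ) (x y : Λ) :
    ⁅(siteSpin n x 0 * siteSpin n y 0 : Op Λ (n + 1)), ∑ u : Λ, a u • (siteSpin n u 0 : Op Λ (n + 1))⁆ = 0 := by
  have hc : ∀ u, Commute (siteSpin n x 0 * siteSpin n y 0 : Op Λ (n + 1)) (siteSpin n u 0) := by
    intro u
    refine Commute.mul_left ?_ ?_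
    · by_cases hux : x = u
      · subst hux; exact Commute.refl _
      · exact siteSpin_commute_of_ne_holds n hux 0 0
    · by_cases huy : y = u
      · subst huy; exact Commute.refl _
      · exact siteSpin_commute_of_ne_holds n huy 0 0
  rw [lie_sum]
  exact sum_eq_zero fun u _ => by rw [lie_smul, (hc u).lie_eq, smul_zero]

/-- **The anisotropic bond double commutator** (B–U (4.27)–(4.28), per ordered pair): for `x ≠ y`,
`A = Σ_u a_u S⁰_u` and the summand `T = p S⁰S⁰ + q S¹S¹ + r S²S²`,
`[A, [T, A]] = q(-(a_x² + a_y²) S¹S¹ + 2a_xa_y S²S²) + r(-(a_x² + a_y²) S²S² + 2a_xa_y S¹S¹)`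
(`lie_lie_bond`, `lie_lie_zbond`, and `[S⁰S⁰, A] = 0`). [cite: BjornbergUeltschi2022, eq. (4.28)] -/
theorem lie_lie_anisotropic_summand (a : Λ → ℂ) {x y : Λ} (hxy : x ≠ y) (p q r : ℝ) :
    ⁅(∑ u : Λ, a u • (siteSpin n u 0 : Op Λ (n + 1))),
      ⁅(p : ℂ) • (siteSpin n x 0 * siteSpin n y 0) + (q : ℂ) • (siteSpin n x 1 * siteSpin n y 1) +
          (r : ℂ) • (siteSpin n x 2 * siteSpin n y 2),
        ∑ u : Λ, a u • (siteSpin n u 0 : Op Λ (n + 1))⁆⁆ =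
      (q : ℂ) • (-(a x ^ 2 + a y ^ 2) • (siteSpin n x 1 * siteSpin n y 1) +
          (2 * a x * a y) • (siteSpin n x 2 * siteSpin n y 2)) +
        (r : ℂ) • (-(a x ^ 2 + a y ^ 2) • (siteSpin n x 2 * siteSpin n y 2) +
          (2 * a x * a y) • (siteSpin n x 1 * siteSpin n y 1)) := by
  have h0 := lie_xxbond_wave_eq_zero a x y (n := n)
  have hb := lie_lie_bond a hxy (n := n)
  have hz := lie_lie_zbond a hxy (n := n)
  have h1 : ⁅(∑ u : Λ, a u • (siteSpin n u 0 : Op Λ (n + 1))),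
      ⁅(siteSpin n x 1 * siteSpin n y 1 : Op Λ (n + 1)), ∑ u : Λ, a u • (siteSpin n u 0 : Op Λ (n + 1))⁆⁆ =
      -(a x ^ 2 + a y ^ 2) • (siteSpin n x 1 * siteSpin n y 1) +
        (2 * a x * a y) • (siteSpin n x 2 * siteSpin n y 2) := by
    rw [add_lie, h0, zero_add] at hb
    exact hb
  rw [add_lie, add_lie, smul_lie, smul_lie, smul_lie, h0, smul_zero, zero_add, lie_add, lie_smul,
    lie_smul, h1, hz]

end DoubleCommutator

section HamiltonianDC

variable (L : ℕ) [NeZero L] (n : ℕ)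

/-- `cos` of the torus phase is even: `cos(q·(-z)) = cos(q·z)` (through the characters). [folklore] -/
theorem cos_torusPhase_neg (q z : TorusSite d L) :
    Real.cos (torusPhase L q (-z)) = Real.cos (torusPhase L q z) := by
  rw [← torusChar_re, ← torusChar_re, torusChar_neg, Complex.star_def, Complex.conj_re]

/-- **The double commutator of `H(p,q,r)` with a wave of the first component**:
`[A,[H,A]] = Σ_x Σ_{y∼x} (q((a_x²+a_y²)S¹S¹ - 2a_xa_yS²S²) + r((a_x²+a_y²)S²S² - 2a_xa_yS¹S¹))`.
[cite: BjornbergUeltschi2022, eq. (4.28)] -/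
theorem lie_lie_anisotropicTorus (a : TorusSite d L → ℂ) (p q r : ℝ) :
    ⁅(∑ u : TorusSite d L, a u • (siteSpin n u 0 : Op (TorusSite d L) (n + 1))),
      ⁅anisotropicTorus d L n p q r,
        ∑ u : TorusSite d L, a u • (siteSpin n u 0 : Op (TorusSite d L) (n + 1))⁆⁆ =
      ∑ x : TorusSite d L, ∑ y : TorusSite d L, if (torusGraph d L).Adj x y then
        (q : ℂ) • ((a x ^ 2 + a y ^ 2) • (siteSpin n x 1 * siteSpin n y 1) -
            (2 * a x * a y) • (siteSpin n x 2 * siteSpin n y 2)) +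
          (r : ℂ) • ((a x ^ 2 + a y ^ 2) • (siteSpin n x 2 * siteSpin n y 2) -
            (2 * a x * a y) • (siteSpin n x 1 * siteSpin n y 1))
      else 0 := by
  generalize hA : (∑ u : TorusSite d L, a u • (siteSpin n u 0 : Op (TorusSite d L) (n + 1))) = A
  rw [anisotropicTorus_eq, neg_lie, lie_neg, sum_lie, lie_sum, ← sum_neg_distrib]
  refine sum_congr rfl fun x _ => ?_
  rw [sum_lie, lie_sum, ← sum_neg_distrib]
  refine sum_congr rfl fun y _ => ?_
  split_ifs with h
  · rw [← hA, lie_lie_anisotropic_summand a ((torusGraph d L).ne_of_adj h)]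
    module
  · rw [zero_lie, lie_zero, neg_zero]

/-- The ground-state expectation of the double commutator for a real wave, pair by pair:
`Re ω([A,[H',A]]) = ΣΣ_{x∼y} (J₂((a_x²+a_y²)G¹ - 2a_xa_yG²) + J₁((a_x²+a_y²)G² - 2a_xa_yG¹))(x,y)`.
[cite: BjornbergUeltschi2022, eqs. (4.28)–(4.29)] -/
theorem re_groundStateFunctional_xyz_lie_lie (J₁ J₂ : ℝ) (a : TorusSite d L → ℝ) :
    ((anisotropicTorus d L n 1 J₂ J₁).groundStateFunctional
      ⁅(∑ u : TorusSite d L, (a u : ℂ) • (siteSpin n u 0 : Op (TorusSite d L) (n + 1))),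
        ⁅anisotropicTorus d L n 1 J₂ J₁,
          ∑ u : TorusSite d L, (a u : ℂ) • (siteSpin n u 0 : Op (TorusSite d L) (n + 1))⁆⁆).re =
      ∑ x : TorusSite d L, ∑ y : TorusSite d L, if (torusGraph d L).Adj x y then
        J₂ * ((a x ^ 2 + a y ^ 2) * xyzGroundCorr 1 L n J₁ J₂ x y -
            2 * a x * a y * xyzGroundCorr 2 L n J₁ J₂ x y) +
          J₁ * ((a x ^ 2 + a y ^ 2) * xyzGroundCorr 2 L n J₁ J₂ x y -
            2 * a x * a y * xyzGroundCorr 1 L n J₁ J₂ x y)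
      else 0 := by
  rw [lie_lie_anisotropicTorus, map_sum, Complex.re_sum]
  refine sum_congr rfl fun x _ => ?_
  rw [map_sum, Complex.re_sum]
  refine sum_congr rfl fun y _ => ?_
  split_ifs with h
  · rw [show ((a x : ℂ) ^ 2 + (a y : ℂ) ^ 2) = ((a x ^ 2 + a y ^ 2 : ℝ) : ℂ) by push_cast; ring,
      show (2 * (a x : ℂ) * (a y : ℂ)) = ((2 * a x * a y : ℝ) : ℂ) by push_cast; ring]
    simp only [map_add, map_sub, LinearMap.map_smul, smul_eq_mul, Complex.add_re, Complex.sub_re,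
      Complex.re_ofReal_mul]
    rw [← xyzGroundCorr_of_neZero, ← xyzGroundCorr_of_neZero]
  · simp

/-- **The two modes together** (B–U (4.28)–(4.29) at `β = ∞`): for side `L ≥ 3`,
`Re ω([C_q,[H',C_q]]) + Re ω([D_q,[H',D_q]]) =
4 Σᵢ Σ_z ((J₂ - J₁ cos qᵢ) G¹(z,z+eᵢ) + (J₁ - J₂ cos qᵢ) G²(z,z+eᵢ))`
(`cos² + sin² = 1`, `cos(q·x)cos(q·y) + sin(q·x)sin(q·y) = cos(q·(x-y))`, ordered pairs are twice
the bonds `(z, z+eᵢ)`). [cite: BjornbergUeltschi2022, eq. (4.29)] -/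
theorem re_groundStateFunctional_xyz_lie_lie_modes (hL : 3 ≤ L) (J₁ J₂ : ℝ) (q : TorusSite d L) :
    ((anisotropicTorus d L n 1 J₂ J₁).groundStateFunctional
        ⁅xyCosMode L n q, ⁅anisotropicTorus d L n 1 J₂ J₁, xyCosMode L n q⁆⁆).re +
      ((anisotropicTorus d L n 1 J₂ J₁).groundStateFunctional
        ⁅xySinMode L n q, ⁅anisotropicTorus d L n 1 J₂ J₁, xySinMode L n q⁆⁆).re =
      4 * ∑ i : Fin d, ∑ z : TorusSite d L,
        ((J₂ - J₁ * Real.cos (latticeMomentum L q i)) * xyzGroundCorr 1 L n J₁ J₂ z (z + Pi.single i 1) +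
          (J₁ - J₂ * Real.cos (latticeMomentum L q i)) * xyzGroundCorr 2 L n J₁ J₂ z (z + Pi.single i 1)) := by
  rw [xyCosMode, xySinMode, re_groundStateFunctional_xyz_lie_lie, re_groundStateFunctional_xyz_lie_lie,
    ← sum_add_distrib]
  simp_rw [← sum_add_distrib]
  -- combine the two kernels
  set F : TorusSite d L → TorusSite d L → ℝ := fun x y =>
    2 * ((J₂ - J₁ * Real.cos (torusPhase L q (x - y))) * xyzGroundCorr 1 L n J₁ J₂ x y +
      (J₁ - J₂ * Real.cos (torusPhase L q (x - y))) * xyzGroundCorr 2 L n J₁ J₂ x y) with hF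
  have hcomb : ∀ x y : TorusSite d L,
      ((if (torusGraph d L).Adj x y then
          J₂ * ((Real.cos (torusPhase L q x) ^ 2 + Real.cos (torusPhase L q y) ^ 2) *
              xyzGroundCorr 1 L n J₁ J₂ x y -
            2 * Real.cos (torusPhase L q x) * Real.cos (torusPhase L q y) * xyzGroundCorr 2 L n J₁ J₂ x y) +
          J₁ * ((Real.cos (torusPhase L q x) ^ 2 + Real.cos (torusPhase L q y) ^ 2) *
              xyzGroundCorr 2 L n J₁ J₂ x y -
            2 * Real.cos (torusPhase L q x) * Real.cos (torusPhase L q y) * xyzGroundCorr 1 L n J₁ J₂ x y)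
        else 0) +
        (if (torusGraph d L).Adj x y then
          J₂ * ((Real.sin (torusPhase L q x) ^ 2 + Real.sin (torusPhase L q y) ^ 2) *
              xyzGroundCorr 1 L n J₁ J₂ x y -
            2 * Real.sin (torusPhase L q x) * Real.sin (torusPhase L q y) * xyzGroundCorr 2 L n J₁ J₂ x y) +
          J₁ * ((Real.sin (torusPhase L q x) ^ 2 + Real.sin (torusPhase L q y) ^ 2) *
              xyzGroundCorr 2 L n J₁ J₂ x y -
            2 * Real.sin (torusPhase L q x) * Real.sin (torusPhase L q y) * xyzGroundCorr 1 L n J₁ J₂ x y)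
        else 0)) =
      if (torusGraph d L).Adj x y then F x y else 0 := by
    intro x y
    split_ifs with h
    · simp only [hF]
      rw [cos_torusPhase_sub]
      linear_combination (J₂ * xyzGroundCorr 1 L n J₁ J₂ x y + J₁ * xyzGroundCorr 2 L n J₁ J₂ x y) *
        Real.cos_sq_add_sin_sq (torusPhase L q x) +
        (J₂ * xyzGroundCorr 1 L n J₁ J₂ x y + J₁ * xyzGroundCorr 2 L n J₁ J₂ x y) *
        Real.cos_sq_add_sin_sq (torusPhase L q y)
    · simp
  simp_rw [hcomb]
  have hFsymm : ∀ x y : TorusSite d L, (torusGraph d L).Adj x y → F x y = F y x := by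
    intro x y _
    simp only [hF]
    rw [xyzGroundCorr_symm L n J₁ J₂ 1 x y, xyzGroundCorr_symm L n J₁ J₂ 2 x y, ← neg_sub y x,
      cos_torusPhase_neg]
  rw [sum_sum_ite_torusGraph_adj hL F hFsymm, sum_comm, nsmul_eq_mul, Nat.cast_ofNat, mul_sum,
    mul_sum]
  refine sum_congr rfl fun i _ => ?_
  rw [mul_sum, mul_sum]
  refine sum_congr rfl fun z _ => ?_
  simp only [hF]
  rw [sub_add_cancel_left, cos_torusPhase_neg_single]
  ring

end HamiltonianDC

/-! ### (SYM) Axis permutations: direction independence of the bond correlations -/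

section CoordinatePermutation

variable (L : ℕ) [NeZero L] (n : ℕ)

/-- **The anisotropic Hamiltonian is invariant under permutations of the coordinate axes**
(relabelling of sites `x ↦ x ∘ s`, acting on tensor indices by `σ ↦ σ ∘ π`). [folklore] -/
theorem anisotropicTorus_submatrix_comp_perm (s : Equiv.Perm (Fin d)) (a b c : ℝ) :
    (anisotropicTorus d L n a b c).submatrix
        (fun σ : TensorIndex (TorusSite d L) (n + 1) =>
          σ ∘ (Equiv.arrowCongr s.symm (Equiv.refl (ZMod L))))
        (fun σ => σ ∘ (Equiv.arrowCongr s.symm (Equiv.refl (ZMod L)))) =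
      anisotropicTorus d L n a b c := by
  set π : TorusSite d L ≃ TorusSite d L := Equiv.arrowCongr s.symm (Equiv.refl (ZMod L)) with hπ
  have hbij := bijective_comp_equiv (q := n + 1) π
  rw [anisotropicTorus_eq]
  simp only [submatrix_neg, Pi.neg_apply, submatrix_finset_sum]
  rw [neg_inj]
  -- the summand transforms covariantly
  have hT : ∀ x y : TorusSite d L,
      ((if (torusGraph d L).Adj x y then
        (a : ℂ) • (siteSpin n x 0 * siteSpin n y 0) + (b : ℂ) • (siteSpin n x 1 * siteSpin n y 1) +
          (c : ℂ) • (siteSpin n x 2 * siteSpin n y 2)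
        else (0 : Op (TorusSite d L) (n + 1))).submatrix (fun σ => σ ∘ π) (fun σ => σ ∘ π)) =
      if (torusGraph d L).Adj (π x) (π y) then
        (a : ℂ) • (siteSpin n (π x) 0 * siteSpin n (π y) 0) +
          (b : ℂ) • (siteSpin n (π x) 1 * siteSpin n (π y) 1) +
          (c : ℂ) • (siteSpin n (π x) 2 * siteSpin n (π y) 2)
      else 0 := by
    intro x y
    have hadj : (torusGraph d L).Adj (π x) (π y) ↔ (torusGraph d L).Adj x y := by
      rw [hπ, arrowCongr_symm_apply, arrowCongr_symm_apply]
      exact torusGraph_adj_comp_perm L s x y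
    by_cases h : (torusGraph d L).Adj x y
    · rw [if_pos h, if_pos (hadj.2 h)]
      simp only [submatrix_add, submatrix_smul, Pi.add_apply, Pi.smul_apply,
        Matrix.submatrix_mul _ _ _ _ _ hbij, siteSpin_submatrix_comp]
    · rw [if_neg h, if_neg (fun h' => h (hadj.1 h')), submatrix_zero, Pi.zero_apply, Pi.zero_apply]
  simp_rw [hT]
  exact Equiv.sum_comp π (fun x => ∑ y, (if (torusGraph d L).Adj x (π y) then
      (a : ℂ) • (siteSpin n x 0 * siteSpin n (π y) 0) + (b : ℂ) • (siteSpin n x 1 * siteSpin n (π y) 1) +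
        (c : ℂ) • (siteSpin n x 2 * siteSpin n (π y) 2) else 0)) |>.trans
    (sum_congr rfl fun x _ => Equiv.sum_comp π (fun y => if (torusGraph d L).Adj x y then
      (a : ℂ) • (siteSpin n x 0 * siteSpin n y 0) + (b : ℂ) • (siteSpin n x 1 * siteSpin n y 1) +
        (c : ℂ) • (siteSpin n x 2 * siteSpin n y 2) else 0))

/-- The two-point functions of `H'` are invariant under permutations of the axes. [folklore] -/
theorem xyzGroundCorr_comp_perm (J₁ J₂ : ℝ) (s : Equiv.Perm (Fin d)) (α : Fin 3) (x y : TorusSite d L) :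
    xyzGroundCorr α L n J₁ J₂ (x ∘ s) (y ∘ s) = xyzGroundCorr α L n J₁ J₂ x y := by
  rw [xyzGroundCorr_of_neZero, xyzGroundCorr_of_neZero, ← arrowCongr_symm_apply L s x,
    ← arrowCongr_symm_apply L s y, ← siteSpin_submatrix_comp n _ x α,
    ← siteSpin_submatrix_comp n _ y α,
    ← Matrix.submatrix_mul _ _ _ _ _ (bijective_comp_equiv (q := n + 1) _),
    groundStateFunctional_submatrix_comp (anisotropicTorus_isHermitian L n 1 J₂ J₁ (d := d)) _
      (anisotropicTorus_submatrix_comp_perm L n s 1 J₂ J₁)]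

/-- **Direction independence** (B–U: `e(k)` of (4.33) "using lattice symmetries"):
`Σ_z Gᵅ(z, z+eᵢ) = L^d cᵅ` for every direction `i`. [cite: BjornbergUeltschi2022, (4.33)–(4.34)] -/
theorem sum_xyzGroundCorr_dir_eq_bondCorr (hd : 0 < d) (J₁ J₂ : ℝ) (α : Fin 3) (i : Fin d) :
    ∑ z : TorusSite d L, xyzGroundCorr α L n J₁ J₂ z (z + Pi.single i 1) =
      xyzBondCorr (d := d) α L n J₁ J₂ * (L : ℝ) ^ d := by
  have hL : (0 : ℝ) < (L : ℝ) ^ d := by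
    have : (0 : ℝ) < L := by exact_mod_cast Nat.pos_of_ne_zero (NeZero.ne L)
    positivity
  have hd' : (0 : ℝ) < d := by exact_mod_cast hd
  have hdir : ∀ j : Fin d, ∑ z : TorusSite d L, xyzGroundCorr α L n J₁ J₂ z (z + Pi.single j 1) =
      ∑ z : TorusSite d L, xyzGroundCorr α L n J₁ J₂ z (z + Pi.single i 1) := by
    intro j
    have hsi : (Equiv.swap j i).symm j = i := by rw [Equiv.symm_swap, Equiv.swap_apply_left]
    calc ∑ z : TorusSite d L, xyzGroundCorr α L n J₁ J₂ z (z + Pi.single j 1)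
        = ∑ z : TorusSite d L, xyzGroundCorr α L n J₁ J₂ (z ∘ Equiv.swap j i)
            ((z ∘ Equiv.swap j i : TorusSite d L) + Pi.single i 1) :=
          sum_congr rfl fun z _ => by
            rw [← xyzGroundCorr_comp_perm L n J₁ J₂ (Equiv.swap j i) α z, add_single_comp_perm, hsi]
      _ = ∑ z : TorusSite d L, xyzGroundCorr α L n J₁ J₂ z (z + Pi.single i 1) :=
          (Equiv.arrowCongr (Equiv.swap j i).symm (Equiv.refl (ZMod L))).sum_comp
            (fun z => xyzGroundCorr α L n J₁ J₂ z (z + Pi.single i 1))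
  rw [xyzBondCorr_of_neZero, sum_comm, sum_congr rfl fun j _ => hdir j, sum_const, card_univ,
    Fintype.card_fin, nsmul_eq_mul]
  field_simp

end CoordinatePermutation

/-! ### (A) Gaussian domination ⇒ the infrared bound at `T = 0` -/

section Infrared

variable (L : ℕ) [NeZero L] (n : ℕ) (J₁ J₂ : ℝ)

/-- **The structure factor through the modes**: `L^d ĝ⁰_q = Re ω(C_q²) + Re ω(D_q²)`.
[cite: BjornbergUeltschi2022, eq. (4.23)] -/
theorem xyzStructureFactor_eq_modes (q : TorusSite d L) :
    xyzStructureFactor L n J₁ J₂ q * (L : ℝ) ^ d =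
      ((anisotropicTorus d L n 1 J₂ J₁).groundStateFunctional (xyCosMode L n q * xyCosMode L n q)).re +
        ((anisotropicTorus d L n 1 J₂ J₁).groundStateFunctional (xySinMode L n q * xySinMode L n q)).re := by
  have hL : (0 : ℝ) < (L : ℝ) ^ d := by
    have : (0 : ℝ) < L := by exact_mod_cast Nat.pos_of_ne_zero (NeZero.ne L)
    positivity
  rw [xyzStructureFactor_of_neZero, div_mul_cancel₀ _ hL.ne', xyCosMode, xySinMode,
    groundStateFunctional_realWave_mul, groundStateFunctional_realWave_mul, Complex.re_sum,
    Complex.re_sum, ← sum_add_distrib]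
  refine sum_congr rfl fun x _ => ?_
  rw [Complex.re_sum, Complex.re_sum, ← sum_add_distrib]
  refine sum_congr rfl fun y _ => ?_
  rw [Complex.re_ofReal_mul, Complex.re_ofReal_mul, xyzGroundCorr_of_neZero, cos_torusPhase_sub]
  ring

/-- **One mode** (B–U's Gaussian domination (5.20) at second order, here at `β = ∞` through
`Matrix.groundState_infraredBound_quadratic`): if `E₀(H') ≤ E₀(H' - 2V_h + Q(h))` for all fields
and `V_h = rW`, `r ≠ 0`, `W` Hermitian, then for all real `μ`,
`0 ≤ r⁻²Q(h) + 2μ · 4 Re ω(W²) + μ² · 4 Re ω(W(H' - E₀)W)`.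
[cite: BjornbergUeltschi2022, Lemma 4.1 and (5.20)] [cite: KLS1988JSP, eqs. (18)–(19)] -/
theorem xyz_modeQuadratic_nonneg
    (hGD : ∀ h : TorusSite d L → ℝ,
      (anisotropicTorus d L n 1 J₂ J₁).groundEnergy ≤
        (anisotropicTorus d L n 1 J₂ J₁ - (2 : ℂ) • xyGradField L n h +
          ((xyFieldEnergy L h : ℝ) : ℂ) • 1).groundEnergy)
    {h : TorusSite d L → ℝ} {W : Op (TorusSite d L) (n + 1)} (hW : W.IsHermitian) {r : ℝ}
    (hVh : xyGradField L n h = (r : ℂ) • W) (hr : r ≠ 0) (μ : ℝ) :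
    0 ≤ r⁻¹ ^ 2 * xyFieldEnergy L h +
      2 * μ * (4 * ((anisotropicTorus d L n 1 J₂ J₁).groundStateFunctional (W * W)).re) +
      μ ^ 2 * (4 * ((anisotropicTorus d L n 1 J₂ J₁).groundStateFunctional
        (W * (anisotropicTorus d L n 1 J₂ J₁ - ((anisotropicTorus d L n 1 J₂ J₁).groundEnergy : ℂ) • 1) * W)).re) := by
  set H := anisotropicTorus d L n 1 J₂ J₁ with hH
  have hV : xyGradField L n (r⁻¹ • h) = W := by
    rw [xyGradField_smul, hVh, smul_smul, ← Complex.ofReal_mul, inv_mul_cancel₀ hr,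
      Complex.ofReal_one, one_smul]
  have hQ : xyFieldEnergy L (r⁻¹ • h) = r⁻¹ ^ 2 * xyFieldEnergy L h := xyFieldEnergy_smul L r⁻¹ h
  have hVherm : ((-2 : ℂ) • W).IsHermitian := by
    have : ((-2 : ℂ) • W) = (((-2 : ℝ) : ℂ) • W) := by push_cast; rfl
    rw [this]
    exact hW.ofReal_smul _
  have key := Matrix.groundState_infraredBound_quadratic (anisotropicTorus_isHermitian L n 1 J₂ J₁ (d := d))
    hVherm (Q := 2 * (r⁻¹ ^ 2 * xyFieldEnergy L h)) (fun t => by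
      have ht := hGD (t • (r⁻¹ • h))
      rw [xyGradField_smul, hV, xyFieldEnergy_smul, hQ] at ht
      have hform : H - (2 : ℂ) • ((t : ℂ) • W) + (((t ^ 2 * (r⁻¹ ^ 2 * xyFieldEnergy L h) : ℝ) : ℂ)) • 1 =
          H + (t : ℂ) • ((-2 : ℂ) • W) +
            ((t ^ 2 * (2 * (r⁻¹ ^ 2 * xyFieldEnergy L h)) / 2 : ℝ) : ℂ) • (1 : Op (TorusSite d L) (n + 1)) := by
        rw [show t ^ 2 * (2 * (r⁻¹ ^ 2 * xyFieldEnergy L h)) / 2 = t ^ 2 * (r⁻¹ ^ 2 * xyFieldEnergy L h) by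
          ring, smul_smul, smul_smul, sub_eq_add_neg, ← neg_smul, mul_comm (t : ℂ) (-2 : ℂ), neg_mul]
      rw [hform] at ht
      exact ht) μ
  have e1 : ((-2 : ℂ) • W) * ((-2 : ℂ) • W) = (4 : ℂ) • (W * W) := by
    rw [smul_mul_smul_comm]; norm_num
  have e2 : ((-2 : ℂ) • W) * (H - (H.groundEnergy : ℂ) • 1) * ((-2 : ℂ) • W) =
      (4 : ℂ) • (W * (H - (H.groundEnergy : ℂ) • 1) * W) := by
    simp only [smul_mul_assoc, mul_smul_comm, smul_smul, Matrix.mul_assoc]; norm_num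
  rw [e1, e2, LinearMap.map_smul, LinearMap.map_smul, smul_eq_mul, smul_eq_mul] at key
  have e3 : ∀ z : ℂ, ((4 : ℂ) * z).re = 4 * z.re := fun z => by
    rw [show (4 : ℂ) = ((4 : ℝ) : ℂ) by norm_num, Complex.re_ofReal_mul]
  rw [e3, e3] at key
  linarith

/-- **(GD) ⇒ (A) in finite volume** (B–U Lemma 4.4 at `β = ∞`: `ĝ(k) ≤ √(e(k)/2ε(k))` with
`e(k) = Σᵢ(α' - β' cos kᵢ)`, `ε(k) = 2E_k`). For side `L ≥ 3`, `d ≥ 1`, every spin, and every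
momentum `q ≠ 0`: if `E₀(H') ≤ E₀(H' - 2V_h + Q(h))` for all real fields `h`, then
`0 ≤ ĝ⁰_q` and `(ĝ⁰_q)² E_q ≤ ¼ Σᵢ (α' - β' cos qᵢ)`, `α' = J₂c¹ + J₁c²`, `β' = J₁c¹ + J₂c²`.
The modes `C_q`, `D_q` give two quadratic inequalities whose sum has nonpositive discriminant:
`(L^d ĝ)² ≤ (L^d/8E_q)(X/2)`, `X = Re ω([C,[H',C]] + [D,[H',D]]) = 4L^d Σᵢ(α' - β' cos qᵢ)`.
[cite: BjornbergUeltschi2022, Lemma 4.4, (4.26)–(4.29), (4.33)] -/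
theorem xyz_infraredBound_of_groundEnergy_le (hL : 3 ≤ L) (hd : 0 < d)
    (hGD : ∀ h : TorusSite d L → ℝ,
      (anisotropicTorus d L n 1 J₂ J₁).groundEnergy ≤
        (anisotropicTorus d L n 1 J₂ J₁ - (2 : ℂ) • xyGradField L n h +
          ((xyFieldEnergy L h : ℝ) : ℂ) • 1).groundEnergy)
    (q : TorusSite d L) (hq : q ≠ 0) :
    0 ≤ xyzStructureFactor L n J₁ J₂ q ∧
      xyzStructureFactor L n J₁ J₂ q ^ 2 * dispersion (latticeMomentum L q) ≤
        (1 / 4 : ℝ) * ∑ i, ((J₂ * xyzBondCorr (d := d) 1 L n J₁ J₂ + J₁ * xyzBondCorr (d := d) 2 L n J₁ J₂) -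
          (J₁ * xyzBondCorr (d := d) 1 L n J₁ J₂ + J₂ * xyzBondCorr (d := d) 2 L n J₁ J₂) *
            Real.cos (latticeMomentum L q i)) := by
  set H : Op (TorusSite d L) (n + 1) := anisotropicTorus d L n 1 J₂ J₁ with hH_def
  have hH : H.IsHermitian := anisotropicTorus_isHermitian L n 1 J₂ J₁
  set E : ℝ := dispersion (latticeMomentum L q) with hE_def
  have hE : 0 < E := dispersion_latticeMomentum_pos hq
  set C : Op (TorusSite d L) (n + 1) := xyCosMode L n q with hC_def
  set D : Op (TorusSite d L) (n + 1) := xySinMode L n q with hD_def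
  set K : Op (TorusSite d L) (n + 1) := H - (H.groundEnergy : ℂ) • 1 with hK_def
  set aC : ℝ := (H.groundStateFunctional (C * C)).re with haC_def
  set aD : ℝ := (H.groundStateFunctional (D * D)).re with haD_def
  set bC : ℝ := (H.groundStateFunctional (C * K * C)).re with hbC_def
  set bD : ℝ := (H.groundStateFunctional (D * K * D)).re with hbD_def
  set Qc : ℝ := xyFieldEnergy L (fun x => Real.cos (torusPhase L q x)) with hQc_def
  set Qs : ℝ := xyFieldEnergy L (fun x => Real.sin (torusPhase L q x)) with hQs_def
  have hLd : 0 < (L : ℝ) ^ d := by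
    have : (0 : ℝ) < L := by exact_mod_cast Nat.pos_of_ne_zero (NeZero.ne L)
    positivity
  set Sg : ℝ := ∑ i, ((J₂ * xyzBondCorr (d := d) 1 L n J₁ J₂ + J₁ * xyzBondCorr (d := d) 2 L n J₁ J₂) -
    (J₁ * xyzBondCorr (d := d) 1 L n J₁ J₂ + J₂ * xyzBondCorr (d := d) 2 L n J₁ J₂) *
      Real.cos (latticeMomentum L q i)) with hSg_def
  have h2E : (2 * E) ≠ 0 := by positivity
  -- the two quadratic inequalities
  have hquadC : ∀ μ : ℝ, 0 ≤ (2 * E)⁻¹ ^ 2 * Qc + 2 * μ * (4 * aC) + μ ^ 2 * (4 * bC) := fun μ =>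
    xyz_modeQuadratic_nonneg L n J₁ J₂ hGD (xyCosMode_isHermitian L n q) (xyGradField_cos L n q) h2E μ
  have hquadS : ∀ μ : ℝ, 0 ≤ (2 * E)⁻¹ ^ 2 * Qs + 2 * μ * (4 * aD) + μ ^ 2 * (4 * bD) := fun μ =>
    xyz_modeQuadratic_nonneg L n J₁ J₂ hGD (xySinMode_isHermitian L n q) (xyGradField_sin L n q) h2E μ
  -- their sum and its discriminant
  have hQsum : (2 * E)⁻¹ ^ 2 * Qc + (2 * E)⁻¹ ^ 2 * Qs = (L : ℝ) ^ d / (2 * E) := by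
    have h := xyFieldEnergy_cos_add_sin L q
    rw [← hQc_def, ← hQs_def, ← hE_def] at h
    rw [← mul_add, h]
    field_simp
  have hdisc : (4 * (aC + aD)) ^ 2 ≤ (4 * (bC + bD)) * ((L : ℝ) ^ d / (2 * E)) := by
    have hq' : ∀ x : ℝ, 0 ≤ (4 * (bC + bD)) * (x * x) + 2 * (4 * (aC + aD)) * x + (L : ℝ) ^ d / (2 * E) := by
      intro x
      have h1 := hquadC x
      have h2 := hquadS x
      rw [← hQsum]
      linarith [h1, h2]
    have hd' := discrim_le_zero hq'
    rw [discrim] at hd'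
    nlinarith [hd']
  -- `A = |Λ| ĝ`
  have hA : xyzStructureFactor L n J₁ J₂ q * (L : ℝ) ^ d = aC + aD := xyzStructureFactor_eq_modes L n J₁ J₂ q
  -- `bC + bD = 2 |Λ| Sg`
  have hB : bC + bD = 2 * (L : ℝ) ^ d * Sg := by
    rw [hbC_def, hbD_def, Matrix.re_groundStateFunctional_conj_eq_lie_lie hH C,
      Matrix.re_groundStateFunctional_conj_eq_lie_lie hH D, ← add_div,
      re_groundStateFunctional_xyz_lie_lie_modes L n hL J₁ J₂ q, hSg_def, mul_sum, mul_sum, sum_div]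
    refine sum_congr rfl fun i _ => ?_
    rw [sum_add_distrib, ← mul_sum, ← mul_sum, sum_xyzGroundCorr_dir_eq_bondCorr L n hd J₁ J₂ 1 i,
      sum_xyzGroundCorr_dir_eq_bondCorr L n hd J₁ J₂ 2 i]
    ring
  -- positivity of `A`
  have haC : 0 ≤ aC := re_groundStateFunctional_mul_self_nonneg H (xyCosMode_isHermitian L n q)
  have haD : 0 ≤ aD := re_groundStateFunctional_mul_self_nonneg H (xySinMode_isHermitian L n q)
  have hg0 : 0 ≤ xyzStructureFactor L n J₁ J₂ q := by
    have h0 : 0 ≤ xyzStructureFactor L n J₁ J₂ q * (L : ℝ) ^ d := by rw [hA]; exact add_nonneg haC haD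
    exact nonneg_of_mul_nonneg_left h0 hLd
  refine ⟨hg0, ?_⟩
  rw [hB, ← hA] at hdisc
  have h1 : xyzStructureFactor L n J₁ J₂ q ^ 2 * (4 * E) * ((L : ℝ) ^ d) ^ 2 ≤ Sg * ((L : ℝ) ^ d) ^ 2 := by
    have h2E' : 0 < 2 * E := by positivity
    have := mul_le_mul_of_nonneg_right hdisc h2E'.le
    have e : 4 * (2 * (L : ℝ) ^ d * Sg) * ((L : ℝ) ^ d / (2 * E)) * (2 * E) = 8 * (Sg * ((L : ℝ) ^ d) ^ 2) := by
      field_simp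
      ring
    rw [e] at this
    nlinarith [this]
  have h2 : xyzStructureFactor L n J₁ J₂ q ^ 2 * (4 * E) ≤ Sg :=
    le_of_mul_le_mul_right h1 (by positivity)
  linarith [h2]

end Infrared

/-! ### The frame change: `S²S²` correlations of `H₀` are `S⁰S⁰` correlations of `H'` -/

section Frame

/-- **Covariance of the tracial ground state under unitary conjugation**: for a unitary `W` and
Hermitian `K`, `ω_{WᴴKW}(A) = ω_K(W A Wᴴ)` — both sides are the `β → ∞` limits of the Gibbs states,
which are covariant (`Matrix.gibbsState_conjTranspose_mul_mul`, `Matrix.tendsto_gibbsState_atTop_holds`).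
Bratteli–Robinson II §5.3.1. [folklore] -/
theorem groundStateFunctional_conj_unitary {m : Type*} [Fintype m] [DecidableEq m] [Nonempty m]
    {W : Matrix m m ℂ} (hW : W * Wᴴ = 1) (hW' : Wᴴ * W = 1) {K : Matrix m m ℂ} (hK : K.IsHermitian)
    (A : Matrix m m ℂ) :
    (Wᴴ * K * W).groundStateFunctional A = K.groundStateFunctional (W * A * Wᴴ) := by
  have hK' : (Wᴴ * K * W).IsHermitian := isHermitian_conjTranspose_mul_mul W hK
  have h1 := Matrix.tendsto_gibbsState_atTop_holds hK' A
  have h2 := Matrix.tendsto_gibbsState_atTop_holds hK (W * A * Wᴴ)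
  have heq : (fun β : ℝ => gibbsState β (Wᴴ * K * W) A) = fun β => gibbsState β K (W * A * Wᴴ) :=
    funext fun β => Matrix.gibbsState_conjTranspose_mul_mul hW hW' β K A
  rw [heq] at h1
  exact tendsto_nhds_unique h1 h2

variable (L : ℕ) [NeZero L] (n : ℕ)

/-- **The global quarter turn `W = ⨂V` exchanges the couplings of the first and third components**:
`W H(a,b,c) Wᴴ = H(c,b,a)` (`V Sᶻ Vᴴ = Sˣ`, `V Sˣ Vᴴ = -Sᶻ`, `V Sʸ Vᴴ = Sʸ`).
[cite: BjornbergUeltschi2022, Prop. 2.4] -/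
theorem rotV_conj_anisotropicTorus {V : Matrix (Fin (n + 1)) (Fin (n + 1)) ℂ} (hV : V * Vᴴ = 1)
    (hV' : Vᴴ * V = 1) (hVz : V * SpinOperators.spinZ n * Vᴴ = spinX n)
    (hVx : V * spinX n * Vᴴ = -SpinOperators.spinZ n) (hVy : V * spinY n * Vᴴ = spinY n) (a b c : ℝ) :
    productOp (fun _ : TorusSite d L => V) * anisotropicTorus d L n a b c *
        (productOp (fun _ : TorusSite d L => V))ᴴ = anisotropicTorus d L n c b a := by
  rw [globalOp_conj_anisotropicTorus hV hV' (γ := ![2, 1, 0]) (ε := ![-1, 1, 1])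
    (fun α => by fin_cases α <;> simp) (fun α => by
      fin_cases α
      · simpa using hVx
      · simpa using hVy
      · simpa using hVz) a b c, anisotropicTorus_eq]
  rw [neg_inj]
  refine sum_congr rfl fun x _ => sum_congr rfl fun y _ => ?_
  split_ifs
  · simp only [Matrix.cons_val_zero, Matrix.cons_val_one, Matrix.cons_val]
    abel
  · rfl

/-- **The frame change**: the `S²S²` ground-state correlations of `H₀ = H(J₁, J₂, 1)` are the
`S⁰S⁰` ground-state correlations of `H' = H(1, J₂, J₁) = W H₀ Wᴴ` (all sides `L`; both junk `0`
at `L = 0`). [folklore] -/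
theorem groundStateAxisCorrTorus_eq_xyzGroundCorr (L n : ℕ) (J₁ J₂ : ℝ) (x y : TorusSite d L) :
    groundStateAxisCorrTorus L n J₁ J₂ 1 x y = xyzGroundCorr 0 L n J₁ J₂ x y := by
  rcases Nat.eq_zero_or_pos L with rfl | hL
  · simp [xyzGroundCorr]
  haveI : NeZero L := ⟨hL.ne'⟩
  rw [groundStateAxisCorrTorus_of_neZero, xyzGroundCorr_of_neZero]
  obtain ⟨V, hV, hV', hVz, hVx, hVy⟩ := exists_unitary_conj_spinZ_eq_spinX n
  set W : Op (TorusSite d L) (n + 1) := productOp (fun _ : TorusSite d L => V) with hW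
  have hWa : W * Wᴴ = 1 := productOp_mul_conjTranspose fun _ => hV
  have hWb : Wᴴ * W = 1 := productOp_conjTranspose_mul fun _ => hV'
  have hconj : W * anisotropicTorus d L n J₁ J₂ 1 * Wᴴ = anisotropicTorus d L n 1 J₂ J₁ :=
    rotV_conj_anisotropicTorus L n hV hV' hVz hVx hVy J₁ J₂ 1
  have hH₀ : anisotropicTorus d L n J₁ J₂ 1 = Wᴴ * anisotropicTorus d L n 1 J₂ J₁ * W := by
    rw [← hconj]
    calc anisotropicTorus d L n J₁ J₂ 1
        = (Wᴴ * W) * anisotropicTorus d L n J₁ J₂ 1 * (Wᴴ * W) := by rw [hWb, Matrix.one_mul, Matrix.mul_one]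
      _ = Wᴴ * (W * anisotropicTorus d L n J₁ J₂ 1 * Wᴴ) * W := by simp only [Matrix.mul_assoc]
  have hO : W * (siteSpin n x 2 * siteSpin n y 2) * Wᴴ = siteSpin n x 0 * siteSpin n y 0 := by
    rw [hW, productOp_conj_mul (fun _ => hV'), productOp_conj_siteSpin (fun _ => hV),
      productOp_conj_siteSpin (fun _ => hV), spinVec_two, hVz]
    rfl
  rw [hH₀, groundStateFunctional_conj_unitary hWa hWb (anisotropicTorus_isHermitian L n 1 J₂ J₁ (d := d)), hO]

/-- A priori bound for all sides (junk `0` at `L = 0`). [folklore] -/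
theorem xyzGroundCorr_abs_le' (α : Fin 3) (L n : ℕ) (J₁ J₂ : ℝ) (x y : TorusSite d L) :
    |xyzGroundCorr α L n J₁ J₂ x y| ≤ ((n : ℝ) / 2) ^ 2 := by
  rcases Nat.eq_zero_or_pos L with rfl | hL
  · simp only [xyzGroundCorr, dif_pos, abs_zero]
    positivity
  haveI : NeZero L := ⟨hL.ne'⟩
  exact xyzGroundCorr_abs_le L n J₁ J₂ α x y

/-- **The LRO sequence of the fact is `ℓ⁻ᵈ ĝ⁰_0`** on the torus of side `ℓ = 2k ≥ 2`
(B–U (4.32): "the first term of the right side is equal to the long-range order parameter").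
[cite: BjornbergUeltschi2022, (4.31)–(4.32)] -/
theorem xyz_lroSeq_eq (n k : ℕ) (hk : 1 ≤ k) (J₁ J₂ : ℝ) :
    (∑ x ∈ halfOpenBox d (2 * k), ∑ y ∈ halfOpenBox d (2 * k),
        torusPullback (fun L x y => groundStateAxisCorrTorus (d := d) L n J₁ J₂ 1 x y) (2 * k) x y) /
        ((halfOpenBox d (2 * k)).card : ℝ) ^ 2 =
      xyzStructureFactor (2 * k) n J₁ J₂ (0 : TorusSite d (2 * k)) / ((2 * k : ℕ) : ℝ) ^ d := by
  haveI : NeZero (2 * k) := ⟨by omega⟩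
  have hL : ((2 * k : ℕ) : ℝ) ^ d ≠ 0 := by positivity
  rw [XYOrderProofs.sum_halfOpenBox_torusPullback, card_halfOpenBox, xyzStructureFactor_zero]
  simp only [groundStateAxisCorrTorus_eq_xyzGroundCorr]
  push_cast
  field_simp

/-- Boundedness of the LRO sequence: `|Λ|⁻² Σ_{x,y} G ≤ S²`. [folklore] -/
theorem xyz_lroSeq_le (n k : ℕ) (J₁ J₂ : ℝ) :
    (∑ x ∈ halfOpenBox d (2 * k), ∑ y ∈ halfOpenBox d (2 * k),
        torusPullback (fun L x y => groundStateAxisCorrTorus (d := d) L n J₁ J₂ 1 x y) (2 * k) x y) /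
        ((halfOpenBox d (2 * k)).card : ℝ) ^ 2 ≤ ((n : ℝ) / 2) ^ 2 := by
  have hc : 0 ≤ ((n : ℝ) / 2) ^ 2 := by positivity
  refine div_le_of_le_mul₀ (by positivity) hc ?_
  have hb : ∀ x y : Site d, torusPullback (fun L x y => groundStateAxisCorrTorus (d := d) L n J₁ J₂ 1 x y)
      (2 * k) x y ≤ ((n : ℝ) / 2) ^ 2 := by
    intro x y
    rw [torusPullback_apply, groundStateAxisCorrTorus_eq_xyzGroundCorr]
    exact le_of_abs_le (xyzGroundCorr_abs_le' 0 (2 * k) n J₁ J₂ _ _)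
  calc ∑ x ∈ halfOpenBox d (2 * k), ∑ y ∈ halfOpenBox d (2 * k),
        torusPullback (fun L x y => groundStateAxisCorrTorus (d := d) L n J₁ J₂ 1 x y) (2 * k) x y
      ≤ ∑ x ∈ halfOpenBox d (2 * k), ∑ y ∈ halfOpenBox d (2 * k), ((n : ℝ) / 2) ^ 2 :=
        sum_le_sum fun x _ => sum_le_sum fun y _ => hb x y
    _ = ((n : ℝ) / 2) ^ 2 * ((halfOpenBox d (2 * k)).card : ℝ) ^ 2 := by
        simp only [sum_const, nsmul_eq_mul]
        ring

end Frame

/-! ### Assembly: B–U Theorem 3.2 (second bound) for `d = 2`, `S = ½`, from Gaussian domination -/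

section Assembly

/-- **The pointwise step** (B–U (4.39)–(4.41) at `β = ∞`): if `0 ≤ g`, `g²E ≤ ¼(dα - βC)`,
`α ≥ 0`, `α + β ≥ 0`, `E > 0`, `d > 0`, then `g·(C/d) ≤ ½√α · [(d+C)/E]^{1/2} (C/d)₊`
(for `C > 0`, `dα - βC ≤ α(d + C)`). [cite: BjornbergUeltschi2022, (4.39)–(4.41)] -/
theorem bu_pointwise {g E C dd α β : ℝ} (hg : 0 ≤ g) (hE : 0 < E) (hdd : 0 < dd)
    (hA : g ^ 2 * E ≤ 1 / 4 * (dd * α - β * C)) (hα : 0 ≤ α) (hαβ : 0 ≤ α + β) :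
    g * (C / dd) ≤ 1 / 2 * Real.sqrt α * (Real.sqrt ((dd + C) / E) * max (C / dd) 0) := by
  rcases le_or_gt C 0 with hC | hC
  · calc g * (C / dd) ≤ 0 :=
          mul_nonpos_of_nonneg_of_nonpos hg (div_nonpos_of_nonpos_of_nonneg hC hdd.le)
      _ ≤ _ := by positivity
  · have hCd : 0 ≤ C / dd := by positivity
    rw [max_eq_left hCd, ← mul_assoc]
    refine mul_le_mul_of_nonneg_right ?_ hCd
    rw [mul_assoc, ← Real.sqrt_mul hα]
    have h3 : -β * C ≤ α * C := by nlinarith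
    have h4 : (2 * g) ^ 2 ≤ α * ((dd + C) / E) := by
      rw [mul_div_assoc', le_div_iff₀ hE, show (2 * g) ^ 2 * E = 4 * (g ^ 2 * E) by ring]
      nlinarith
    have h5 : 2 * g ≤ Real.sqrt (α * ((dd + C) / E)) := Real.le_sqrt_of_sq_le h4
    linarith

/-- **Positivity of the lower bound, uniformly in the unknown `α'`** (B–U: "irrespective of the
value of `α(β)`, at least one of the lower bounds is positive"; here: the polarised-state bound
for small `√α'` and the second bound of Theorem 3.2 for large `√α'`, at `S = ½`,
`ρ = -J₂/J₁ ≤ 0.109`, `R ≤ 0.651`): if `α ≥ 0`, `c⁰ + α ≥ ¼`, `J₁α ≤ (J₁ - J₂)c⁰`, `0 < J₁`,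
`0 ≤ -J₂ ≤ 0.109 J₁`, `R ≤ 0.651`, then `c⁰ - ½√α R ≥ 1/2500`.
[cite: BjornbergUeltschi2022, (3.9) and the paragraph after Thm. 3.2] -/
theorem bu_positivity {c0 α R J₁ J₂ : ℝ} (hα : 0 ≤ α) (hV : 1 / 4 ≤ c0 + α)
    (h442 : J₁ * α ≤ (J₁ - J₂) * c0) (hJ₁ : 0 < J₁) (hJ₂ : 0 ≤ -J₂) (hJ₂' : -J₂ ≤ 0.109 * J₁)
    (hR : R ≤ 651 / 1000) :
    1 / 2500 ≤ c0 - 1 / 2 * Real.sqrt α * R := by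
  set a := Real.sqrt α with ha
  have ha0 : 0 ≤ a := Real.sqrt_nonneg α
  have haa : a * a = α := Real.mul_self_sqrt hα
  -- `c0 ≥ α / 1.109`
  have hc0 : 0 ≤ c0 := by
    have h1 : 0 ≤ (J₁ - J₂) * c0 := le_trans (mul_nonneg hJ₁.le hα) h442
    have h2 : 0 < J₁ - J₂ := by linarith
    by_contra hneg
    push Not at hneg
    linarith [mul_neg_of_pos_of_neg h2 hneg]
  have hc1 : α ≤ 1.109 * c0 := by
    have h1 : (J₁ - J₂) * c0 ≤ 1.109 * J₁ * c0 := by nlinarith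
    have h2 : J₁ * α ≤ J₁ * (1.109 * c0) := by nlinarith
    exact le_of_mul_le_mul_left h2 hJ₁
  have haR : 1 / 2 * a * R ≤ a * (651 / 2000) := by nlinarith
  rcases le_or_gt a 0.3626 with hle | hgt
  · -- small `a`: the polarised-state bound `c0 ≥ ¼ - a²`
    nlinarith [mul_nonneg (sub_nonneg.2 hle) (show (0 : ℝ) ≤ a + 0.6881 by linarith)]
  · -- large `a`: the second bound `c0 ≥ a²/1.109`
    nlinarith [mul_nonneg (sub_nonneg.2 hgt.le) (show (0 : ℝ) ≤ a / 1.109 + 0.3626 / 1.109 - 0.3255 by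
      have : (0.3626 : ℝ) / 1.109 - 0.3255 > 0 := by norm_num
      have : 0 ≤ a / 1.109 := by positivity
      linarith)]

/-- **The finite-volume lower bound** (B–U Thm. 3.2, second bound, at `β = ∞`, `d = 2`, `S = ½`,
with the polarised-state bound): on the torus of side `L = 2k ≥ 4`, for `0 < J₁ ≤ 1`,
`0 ≤ -J₂ ≤ 0.109 J₁`, under Gaussian domination for `H' = H(1, J₂, J₁)` and `R_L(2) ≤ 0.651`,
`L⁻² ĝ⁰_0 ≥ 1/2500`: by the sum rule `c⁰ = L⁻²ĝ⁰_0 + L⁻²Σ_{q≠0} ĝ⁰_q (½Σᵢcos qᵢ)`, the infrared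
bound and `bu_pointwise` give `c⁰ ≤ L⁻²ĝ⁰_0 + ½√α' R_L`, and `bu_positivity` applies with (V),
(4.42) and (O)(ii). [cite: BjornbergUeltschi2022, Thm. 3.2 and (4.38)–(4.42)] -/
theorem xyz_lro_lower_bound (k : ℕ) (hk : 2 ≤ k) (J₁ J₂ : ℝ) (hJ₁ : 0 < J₁) (hJ₁' : J₁ ≤ 1)
    (hJ₂ : 0 ≤ -J₂) (hJ₂' : -J₂ ≤ 0.109 * J₁)
    (hGD : haveI : NeZero (2 * k) := ⟨by omega⟩
      ∀ h : TorusSite 2 (2 * k) → ℝ,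
        (anisotropicTorus 2 (2 * k) 1 1 J₂ J₁).groundEnergy ≤
          (anisotropicTorus 2 (2 * k) 1 1 J₂ J₁ - (2 : ℂ) • xyGradField (2 * k) 1 h +
            ((xyFieldEnergy (2 * k) h : ℝ) : ℂ) • 1).groundEnergy)
    (hR : klsRiemannSum 2 (2 * k) ≤ 651 / 1000) :
    haveI : NeZero (2 * k) := ⟨by omega⟩
    (1 / 2500 : ℝ) ≤ xyzStructureFactor (2 * k) 1 J₁ J₂ (0 : TorusSite 2 (2 * k)) / ((2 * k : ℕ) : ℝ) ^ 2 := by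
  haveI : NeZero (2 * k) := ⟨by omega⟩
  have hL3 : 3 ≤ 2 * k := by omega
  have hd : (0 : ℕ) < 2 := by norm_num
  set L := 2 * k with hLdef
  have hLpos : (0 : ℝ) < ((L : ℕ) : ℝ) ^ 2 := by positivity
  set c0 := xyzBondCorr (d := 2) 0 L 1 J₁ J₂ with hc0
  set c1 := xyzBondCorr (d := 2) 1 L 1 J₁ J₂ with hc1
  set c2 := xyzBondCorr (d := 2) 2 L 1 J₁ J₂ with hc2
  set α' := J₂ * c1 + J₁ * c2 with hα'
  set β' := J₁ * c1 + J₂ * c2 with hβ'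
  -- (O): `α' ≥ 0`, `α' + β' ≥ 0`
  obtain ⟨-, hO2, hO3, -⟩ := xyz_orbit_inequalities 1 J₁ J₂ hd k hk
  have hαpos : 0 ≤ α' := hO2
  have hαβ : 0 ≤ α' + β' := by
    have : α' + β' = (J₁ + J₂) * (c1 + c2) := by rw [hα', hβ']; ring
    rw [this]; exact hO3
  -- (V) and (4.42)
  have hV : 1 / 4 ≤ c0 + α' := by
    have h := xyz_polarised_bound L 1 J₁ J₂ hL3 hd
    rw [hα']
    norm_num at h ⊢
    linarith
  have h442 : J₁ * α' ≤ (J₁ - J₂) * c0 := xyz_bu442 1 J₁ J₂ hd k hk hJ₁ hJ₁' (by linarith) (by linarith)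
  -- (C): the sum rule split at `q = 0`
  have hC := xyz_structureFactor_sumRule (by norm_num : 1 ≤ 2) L 1 J₁ J₂
  rw [← hc0, ← add_sum_erase _ _ (mem_univ (0 : TorusSite 2 L)), torusCosSum_zero] at hC
  -- (A): the infrared bound, pointwise
  have hsum : ∑ q ∈ (univ : Finset (TorusSite 2 L)).erase 0,
      xyzStructureFactor L 1 J₁ J₂ q * (torusCosSum L q / (2 : ℕ)) ≤
      1 / 2 * Real.sqrt α' * ∑ q ∈ (univ : Finset (TorusSite 2 L)).erase 0,
        klsIntegrand 2 (latticeMomentum L q) := by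
    rw [mul_sum]
    refine sum_le_sum fun q hq => ?_
    have hq0 : q ≠ 0 := (mem_erase.1 hq).1
    obtain ⟨hg, hAq⟩ := xyz_infraredBound_of_groundEnergy_le L 1 J₁ J₂ hL3 hd hGD q hq0
    rw [← hc1, ← hc2, ← hα', ← hβ', sum_const_sub_mul_cos_latticeMomentum] at hAq
    rw [klsIntegrand_latticeMomentum]
    exact bu_pointwise hg (dispersion_latticeMomentum_pos hq0) (by norm_num) hAq hαpos hαβ
  -- `c⁰ ≤ L⁻² ĝ₀ + ½ √α' R`
  have hRsum : ∑ q ∈ (univ : Finset (TorusSite 2 L)).erase 0, klsIntegrand 2 (latticeMomentum L q) =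
      klsRiemannSum 2 L * ((L : ℕ) : ℝ) ^ 2 := by
    rw [klsRiemannSum_of_neZero, div_mul_cancel₀ _ hLpos.ne']
  have hmain : c0 ≤ xyzStructureFactor L 1 J₁ J₂ (0 : TorusSite 2 L) / ((L : ℕ) : ℝ) ^ 2 +
      1 / 2 * Real.sqrt α' * klsRiemannSum 2 L := by
    have hC' : c0 * ((L : ℕ) : ℝ) ^ 2 = xyzStructureFactor L 1 J₁ J₂ (0 : TorusSite 2 L) * ((2 : ℕ) / (2 : ℕ)) +
        ∑ q ∈ (univ : Finset (TorusSite 2 L)).erase 0,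
          xyzStructureFactor L 1 J₁ J₂ q * (torusCosSum L q / (2 : ℕ)) := by
      rw [← hC, div_mul_cancel₀ _ hLpos.ne']
    rw [hRsum] at hsum
    have : c0 * ((L : ℕ) : ℝ) ^ 2 ≤ xyzStructureFactor L 1 J₁ J₂ (0 : TorusSite 2 L) +
        1 / 2 * Real.sqrt α' * (klsRiemannSum 2 L * ((L : ℕ) : ℝ) ^ 2) := by
      rw [hC', show ((2 : ℕ) : ℝ) / ((2 : ℕ) : ℝ) = 1 by norm_num, mul_one]; linarith
    rw [div_add' _ _ _ hLpos.ne', le_div_iff₀ hLpos]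
    nlinarith
  have hpos := bu_positivity hαpos hV h442 hJ₁ hJ₂ hJ₂' hR
  linarith

/-- **Björnberg–Ueltschi's spin-½ planar window from Gaussian domination.** If ground-state
Gaussian domination `E₀(H') ≤ E₀(H' - 2V_h + Q(h))` holds for the rotated anisotropic
Hamiltonians `H' = anisotropicTorus 2 L 1 1 J₂ J₁` on all even tori of side `L ≥ 4`, all
`0 ≤ J₁`, `J₂ ≤ 0` and all real fields `h` (the third sibling `XYZGroundStateOrderGD.lean`), and
the punctured Riemann sums satisfy `R_L(2) ≤ 0.651` eventually
(`klsRiemannSum_two_eventually_le` of `XYZGroundStateOrderIntegral.lean`), then the fact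
`bjornbergUeltschi2022_ground_lro_spinHalf` holds: eventually `(2k)⁻⁴ Σ_{x,y} ⟨S²_xS²_y⟩ =
(2k)⁻² ĝ⁰_0 ≥ 1/2500`. [cite: BjornbergUeltschi2022, Thm. 3.2 and p. 11] -/
theorem bjornbergUeltschi2022_ground_lro_spinHalf_of_gaussianDomination
    (hGD : ∀ (L : ℕ) [NeZero L], Even L → 4 ≤ L → ∀ (J₁ J₂ : ℝ), 0 ≤ J₁ → J₂ ≤ 0 →
      ∀ h : TorusSite 2 L → ℝ,
        (anisotropicTorus 2 L 1 1 J₂ J₁).groundEnergy ≤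
          (anisotropicTorus 2 L 1 1 J₂ J₁ - (2 : ℂ) • xyGradField L 1 h +
            ((xyFieldEnergy L h : ℝ) : ℂ) • 1).groundEnergy)
    (hR : ∀ᶠ L : ℕ in atTop, klsRiemannSum 2 L ≤ 651 / 1000) :
    bjornbergUeltschi2022_ground_lro_spinHalf := by
  intro J₁ J₂ hJ₁ hJ₁' hJ₂ hJ₂'
  rw [hasEvenTorusLRO_iff]
  have h2k : Tendsto (fun k : ℕ => 2 * k) atTop atTop :=
    tendsto_atTop_atTop.2 fun b => ⟨b, fun k hk => by omega⟩
  have hRk : ∀ᶠ k : ℕ in atTop, klsRiemannSum 2 (2 * k) ≤ 651 / 1000 := h2k.eventually hR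
  have hev : ∀ᶠ k : ℕ in atTop, (1 / 2500 : ℝ) ≤
      (∑ x ∈ halfOpenBox 2 (2 * k), ∑ y ∈ halfOpenBox 2 (2 * k),
          torusPullback (fun L x y => groundStateAxisCorrTorus (d := 2) L 1 J₁ J₂ 1 x y) (2 * k) x y) /
        ((halfOpenBox 2 (2 * k)).card : ℝ) ^ 2 := by
    filter_upwards [hRk, eventually_ge_atTop 2] with k hk hk2
    haveI : NeZero (2 * k) := ⟨by omega⟩
    rw [xyz_lroSeq_eq 1 k (by omega) J₁ J₂]
    exact xyz_lro_lower_bound k hk2 J₁ J₂ hJ₁ hJ₁' hJ₂ hJ₂'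
      (fun h => hGD (2 * k) (even_two_mul k) (by omega) J₁ J₂ hJ₁.le (by linarith) h) hk
  exact lt_of_lt_of_le (by norm_num : (0 : ℝ) < 1 / 2500)
    (le_liminf_of_le (isCoboundedUnder_ge_of_le atTop fun k => xyz_lroSeq_le 1 k J₁ J₂) hev)

end Assembly

end Literature.MathematicalPhysics.QuantumLattice
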